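import Literature.Geometry.Kaehler.ComplexTorusPicardNumberSecondGap
import Literature.Geometry.Kaehler.ComplexTorusIdempotentRelations
import HarnessLib

/-!
# Hulek–Laface 2019, Thm. 1.1 (1), (2) and Thm. 4.2 for EVERY abelian variety: the cases `A ∼ Bᵏ`
# (`B` simple, `dim B ≥ 2`), `Eᵏ × Bˡ`, `Aᵏ × Bˡ` through the type-free form of Prop. 2.4

Layer `Literature/Geometry/Kaehler`, namespace `Literature.Geometry.Kaehler.ComplexTorus`; lane
`lit-hodgefound` (Track 2 foundations library), Layer A4 row A4-13 (self-proposed 2026-08-22, seat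
`lit-hodgefound-p18`, generation 7, row g7-#1). Third file of the chain
`ComplexTorusPicardNumberPoincareLength.lean` (Cor. 2.3 as printed, Prop. 3.1, Cor. 3.2, Thm. 1.1 (1) outside
the case `A ∼ Bᵏ`, `dim B ≥ 2`) → `ComplexTorusPicardNumberSecondGap.lean` (Thm. 1.1 (2), Thm. 4.1, Thm. 4.2
along Poincaré decompositions whose short decompositions consist of elliptic curves).  Those two files carry
the hypotheses `hMurty` / `hell` excluding exactly the cases which the paper settles with MURTY's bound
(Prop. 2.4 / Cor. 2.5: `ρ(Bᵏ) ≤ ½ nk(2k+1)` for a simple abelian variety `B` of dimension `n`, proved from the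
Albert classification).  Here those hypotheses are REMOVED.

Source followed (K. Hulek, R. Laface, *On the Picard numbers of abelian varieties*, Ann. Sc. Norm. Super.
Pisa Cl. Sci. (5) XIX (2019); held text `paper:arxiv-1703.05882`), verbatim: p0002 "**Theorem 1.1.** (1) Fix
`g ≥ 4`. There does not exist any abelian variety of dimension `g` with Picard number `ρ` in the following
range: `(g−1)² + 1 < ρ < g²`. (2) Fix `g ≥ 7`. There does not exist any abelian variety of dimension `g`
with Picard number `ρ` in the following range: `(g−2)² + 4 < ρ < (g−1)² + 1`."; p0006 "**Proposition 2.4**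
(Lemma 3.3 of [Murty84]). Let `A` be a simple abelian variety. Set `e := [K : ℚ]`, `d² := [F : K]`. Then,
for `k ≥ 1`, one has `ρ(Aᵏ) = ½ ek(k+1)` (Type I), `ek(2k+1)` (Type II), `ek(2k−1)` (Type III), `½ ed²k²`
(Type IV). […] **Corollary 2.5.** Let `A` be a simple abelian variety of dimension `n`, and let `k ≥ 1`.
Then `ρ(Aᵏ) ≤ ½ nk(2k+1)`."; p0007–p0008 §3.2 "(b) Let `B` be an `m`-dimensional simple abelian variety,
and suppose `A` is isogenous to `Bᵏ`, for `k := g/m`. […] we can assume `k ≤ g/2`. Then, by Corollary 2.5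
we have `ρ(Bᵏ) ≤ ½ g(2k+1) ≤ ½ g(g+1)` and the claim follows"; §3.3 "If `b > 1`, then `k ≤ g/2` and thus,
by Corollary 2.5, `ρ(Bᵏ) ≤ ½ g(2k+1) ≤ ½ g(g+1) ≤ (g−2)² + 4` […] **Step 2** We now consider abelian
varieties of the form `Eᵏ × Aˡ`, with `E` an elliptic curve, `dim A = a > 1` […]
`ρ(Eᵏ × Aˡ) ≤ k² + ½ al(2l+1)` […] `(g−2)² + 3 < (g−2)² + 4`. **Step 3** The last case is that of products
of the form `Aᵏ × Bˡ`, with `dim A = a > 1`, `dim B = b > 1` […] `< (g−2)² + 4`."; p0009 Thm. 4.2 and its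
proof, cases (a), (b).

## The replacement of Cor. 2.5 (recorded deviation)

Murty's Prop. 2.4 is, type by type, the formula **`ρ(Aᵏ) = k·ρ(A) + C(k,2)·[F : ℚ]`** (`F = End_ℚ(A)`;
with `ρ(A) = e, 3e, e, ½ ed²` and `[F : ℚ] = e, 4e, 4e, ed²` for the four types it returns the printed
`½ ek(k+1)`, `ek(2k+1)`, `ek(2k−1)`, `½ ed²k²`).  In this TYPE-FREE form it holds for every abelian
variety and is the tree's additivity `ρ(X₁ × X₂) = ρ(X₁) + ρ(X₂) + dim_ℚ Hom_ℚ(X₁, X₂)` (Prop. 2.2 with the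
cross term, seat p18's `finrank_neronSeveriGroup_pi`) on the constant family
(`IsAbelianVariety.finrank_neronSeveriGroup_pow`, §2).  Cor. 2.5 then needs the Albert-type restrictions
`ρ(A) ≤ n, 3n/2, n/2, n` (Lange 2023 §5.5, Prop. 5.5.7; not in the tree).  We use instead the type-free
bounds available in the tree: `[F : ℚ] ≤ 2 dim A` for `A` simple (`IsSimple.finrank_endAlgRat_le_card`),
`ρ(A) ≤ [F : ℚ]` (`NS_ℚ(A) ≅ End^s_ℚ(A) ⊆ End_ℚ(A)`, Lange 2023 Prop. 5.2.1 (a) / 2.4.12 (a) — §1), and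
`ρ(A) ≤ (dim A)² − 1` for `A` simple of dimension `≥ 2` (§3), whence
**`ρ(Aᵏ) ≤ k · min(2n, n² − 1) + k(k−1) · n`** (`IsSimple.finrank_neronSeveriGroup_pow_le`).  This is weaker
than Cor. 2.5 by at most `½ nk`, but it still clears EVERY inequality the paper derives from Cor. 2.5 in
§3.2 (b), §3.3 (the case `r(A) = 1`, `b > 1`; Steps 2 and 3) and §4 (Thm. 4.2, cases (a), (b), and `r(A) = 1`)
— §4 below proves these inequalities (the tight spots are `(dim B, k) = (2, 2)` at `g = 4`, where
`ρ(B²) ≤ 2·3 + 4 = 10 = 3² + 1`, `(2, 4)` at `g = 8`, and `E^{g−2} × B` with `B` a simple surface in Step 2,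
all settled by `ρ(B) ≤ 3`).  The statements of Thm. 1.1 and Thm. 4.2 are then exactly as printed, for
every abelian variety.
-- TODO(general form): Murty 1984 Lemma 3.3 / Cor. 2.5 with the Albert-type constants (needs Prop. 5.5.7).

## Contents (theorems only; no definition, no named fact, net debt 0)

* §1 **`IsAbelianVariety.finrank_neronSeveriGroup_le_finrank_endAlgRat`** — `ρ(X) ≤ dim_ℚ End_ℚ(X)`.
* §2 **`IsAbelianVariety.finrank_neronSeveriGroup_pow`** — `ρ(Xᵏ) = k·ρ(X) + C(k,2)·dim_ℚ End_ℚ(X)`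
  (Prop. 2.4, type-free).
* §3 simple factors: `IsSimple.finrank_neronSeveriGroup_le_two_mul_finrank` (`ρ(X) ≤ 2 dim X`),
  **`IsSimple.finrank_neronSeveriGroup_lt_sq`** (`dim X ≥ 2 ⟹ ρ(X) < (dim X)²`, by Poincaré uniqueness:
  `ρ = g²` would make `X ∼ E_θ^g`; `IsSimple.finrank_neronSeveriGroup_succ_le_sq`),
  **`IsSimple.finrank_neronSeveriGroup_pow_le`** (`ρ(Xᵏ) ≤ k·ρ(X) + C(k,2)·(2 dim X)`).
* §4 the arithmetic of §3.2 (b), §3.3 and §4 with these bounds: `pow_bound_le_mul`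
  (`k p + C(k,2)·2b ≤ b k(k+1)`), `pow_bound_le_sq_pred` (`bk ≥ 5`: `≤ (bk−1)²`),
  `pow_bound_le_sq_pred_add_one` (`bk ≥ 4`: `≤ (bk−1)² + 1`), `pow_bound_le_sq_sub_two_add_three`
  (`bk ≥ 7`: `≤ (bk−2)² + 3`), `step_two_bound` (`Eˣ × Bʸ`), `step_three_bound` (`Aᵏ × Bˡ`).
* §5 along a Poincaré decomposition `A ∼ ∏_ν X_ν^{n_ν}`: the one-factor case
  `IsIsogenous.finrank_neronSeveriGroup_bounds_of_card_eq_one`, the two-factor case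
  `IsIsogenous.finrank_neronSeveriGroup_le_of_card_eq_two`, and the four statements of the previous files
  WITHOUT `hMurty` / `hell`: **`IsIsogenous.finrank_neronSeveriGroup_eq_sq_or_le_of_powers'`**,
  **`IsIsogenous.not_lt_finrank_neronSeveriGroup_lt_of_powers'`** (Thm. 1.1 (1), `g ≥ 4`),
  **`IsIsogenous.not_lt_finrank_neronSeveriGroup_lt_secondGap_of_powers'`** (Thm. 1.1 (2), `g ≥ 7`),
  **`IsIsogenous.finrank_neronSeveriGroup_eq_sq_pred_add_one_iff_of_powers'`** (Thm. 4.2 (1), `g ≥ 5`),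
  **`IsIsogenous.finrank_neronSeveriGroup_eq_sq_sub_two_add_four_iff_of_powers'`** (Thm. 4.2 (2), `g ≥ 7`).
* §6 **hypothesis-free, for every abelian variety `A`** (`IsAbelianVariety A`; the Poincaré decomposition with
  nonzero factors is seat p10's `IsRiemannForm.exists_isIsogenous_powers_pos`):
  **`IsAbelianVariety.finrank_neronSeveriGroup_eq_sq_or_le`** (`g ≥ 4 ⟹ ρ(A) = g² ∨ ρ(A) ≤ (g−1)² + 1`),
  **`IsAbelianVariety.not_lt_finrank_neronSeveriGroup_lt`** (Thm. 1.1 (1) as printed),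
  **`IsAbelianVariety.finrank_neronSeveriGroup_le_secondGap_or`** and
  **`IsAbelianVariety.not_lt_finrank_neronSeveriGroup_lt_secondGap`** (Thm. 1.1 (2) as printed).
* §7 (add-only sequel) **Thm. 4.2 hypothesis-free in the printed shapes**:
  **`IsAbelianVariety.finrank_neronSeveriGroup_eq_sq_pred_add_one_iff`** (`g ≥ 5`:
  `ρ(A) = (g−1)² + 1 ⟺ A ∼ E_{θ₁}^{g−1} × E_{θ₂}`, `θ₁ ∈ ℍ` imaginary quadratic, `E_{θ₂} ≁ E_{θ₁}`) and
  **`IsAbelianVariety.finrank_neronSeveriGroup_eq_sq_sub_two_add_four_iff`** (`g ≥ 7`: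
  `ρ(A) = (g−2)² + 4 ⟺ A ∼ E_{θ₁}^{g−2} × E_{θ₂}²`, both CM, non-isogenous); helpers
  `exists_isIsomorphic_ellipticPeriod_of_im_pos` (`dim X = 1 ⟹ X ≅ E_τ`, `τ ∈ ℍ`),
  `exists_isIsomorphic_ellipticPeriod_of_im_pos_of_cm`, `finrank_neronSeveriGroup_ellipticPow_prod_ellipticPow`
  (`ρ(E_{θ₁}ᵃ × E_{θ₂}ᵇ) = a² + b²` for non-isogenous CM curves).
* §8 (add-only sequel) **self-products** (§7.2: "all Picard numbers of abelian varieties […] isogenous to a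
  self-product of a simple abelian variety are bounded by `½ g(g+1)`, unless […] the `g`-fold product of a CM
  elliptic curve"): `pow_bound_le_choose`,
  **`IsIsogenous.finrank_neronSeveriGroup_eq_sq_or_le_choose_of_card_eq_one`** (`r(A) = 1 ⟹ ρ(A) = g² ∨
  ρ(A) ≤ C(g+1, 2)`) and **`IsIsogenous.finrank_neronSeveriGroup_eq_sq_or_le_choose_of_pow`** (`A ∼ Bᵏ`,
  `B` simple).

## References

* [HulekLaface2019PicardNumbersAV] K. Hulek, R. Laface, *On the Picard numbers of abelian varieties*,
  Ann. Sc. Norm. Super. Pisa Cl. Sci. (5) XIX (2019) 1199–1224 (arXiv:1703.05882), Thm. 1.1, §2.1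
  Prop. 2.2 / Cor. 2.3, §2.2 Prop. 2.4 / Cor. 2.5 (Murty) / Cor. 2.6, §3.1 Prop. 3.1, §3.2, §3.3, §4 Thm. 4.2.
* [Lange2023AbelianVarietiesComplex] H. Lange, *Abelian Varieties over the Complex Numbers*, Grundlehren
  Text Edition, Springer (2023), §2.4.2 Prop. 2.4.12 (a) (`NS_ℚ(X) ≅ End^s_ℚ(X)`), §2.4.4 Thm. 2.4.25
  (Poincaré), §2.6.1 p. 139 (`[End_ℚ(X) : ℚ] ∣ 2g` for simple `X`), §5.2 Prop. 5.2.1, §5.5 Prop. 5.5.7.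
* [MumfordAV1970] D. Mumford, *Abelian Varieties* (1970), §19 Cor. 1–2, §21 Application III.
-/

noncomputable section

open Module Matrix Function
open Complex (I)

namespace Literature.Geometry.Kaehler

namespace ComplexTorus

/-- The covering space `E ≅ ℝ^ι` of a complex torus is finite-dimensional over `ℂ`. [cite: Lange2023AbelianVarietiesComplex, §1.1.1] -/
private theorem finiteDimensional_complex_of_period {ι : Type*} [Fintype ι] {E : Type*} [NormedAddCommGroup E]
    [NormedSpace ℂ E] (Φ : (ι → ℝ) ≃L[ℝ] E) : FiniteDimensional ℂ E := by
  haveI : FiniteDimensional ℝ E := LinearEquiv.finiteDimensional Φ.toLinearEquiv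
  exact Module.Finite.of_restrictScalars_finite ℝ ℂ E

/-- `dim_ℂ (Eᵐ) = m · dim_ℂ E`. [folklore] -/
private theorem finrank_fin_fun (m : ℕ) (E : Type*) [NormedAddCommGroup E] [NormedSpace ℂ E]
    [FiniteDimensional ℂ E] : finrank ℂ (Fin m → E) = m * finrank ℂ E := by
  rw [Module.finrank_pi_fintype, Finset.sum_const, Finset.card_univ, Fintype.card_fin, smul_eq_mul]

/-! ## §1 `ρ(X) ≤ dim_ℚ End_ℚ(X)` for an abelian variety -/

section RankBound

variable {ι : Type*} [Fintype ι] [DecidableEq ι] {E : Type*} [NormedAddCommGroup E] [NormedSpace ℂ E]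
  (Φ : (ι → ℝ) ≃L[ℝ] E)

/-- `End^s_ℚ(X) ⊆ End_ℚ(X)`: the symmetric elements for a Rosati involution form a subspace of the
endomorphism algebra. [cite: Lange2023AbelianVarietiesComplex, §2.4.2 (before Prop. 2.4.12), p. 117] -/
theorem symmEndRat_le_toSubmodule (G₀ : Matrix ι ι ℚ) :
    symmEndRat Φ G₀ ≤ Subalgebra.toSubmodule (endAlgRat Φ) := fun _ hA ↦ hA.1

/-- **`ρ(X) ≤ dim_ℚ End_ℚ(X)` for an abelian variety `X`**: `NS_ℚ(X) ≅ End^s_ℚ(X)` (the symmetric elements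
for the Rosati involution of a polarisation, Prop. 2.4.12 (a) / Prop. 5.2.1 (a), the tree's `nsEquivSymmEnd`)
and `End^s_ℚ(X) ⊆ End_ℚ(X)`; `ρ(X) = rk NS(X) = dim_ℚ NS_ℚ(X)`.
[cite: Lange2023AbelianVarietiesComplex, §2.4.2 Prop. 2.4.12 (a) and §5.2 Prop. 5.2.1 (a)] -/
theorem IsAbelianVariety.finrank_neronSeveriGroup_le_finrank_endAlgRat {Φ : (ι → ℝ) ≃L[ℝ] E}
    (hX : IsAbelianVariety Φ) : finrank ℤ (neronSeveriGroup Φ) ≤ finrank ℚ (endAlgRat Φ) := by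
  obtain ⟨η₀, hη₀⟩ := hX
  obtain ⟨G₀, hG₀, hdet⟩ := hη₀.exists_ratMatrix_latticeGram_isUnit
  rw [finrank_neronSeveriGroup_eq_finrank_hodgeClasses, finrank_hodgeClasses_one_eq_finrank_symmEndRat hη₀.1 hG₀ hdet,
    ← Subalgebra.finrank_toSubmodule]
  exact Submodule.finrank_mono (symmEndRat_le_toSubmodule Φ G₀)

end RankBound

/-! ## §2 Prop. 2.4 in type-free form: `ρ(Xᵏ) = k·ρ(X) + C(k,2)·dim_ℚ End_ℚ(X)` -/

section Pow

variable {ι : Type*} [Fintype ι] [DecidableEq ι] {E : Type*} [NormedAddCommGroup E] [NormedSpace ℂ E]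
  (Φ : (ι → ℝ) ≃L[ℝ] E)

/-- `Σ_{l<n} Σ_{k<l} c = C(n, 2) · c` (the number of cross terms of an `n`-fold product). [folklore] -/
private theorem sum_sum_ite_lt_const : ∀ (n c : ℕ), (∑ l : Fin n, ∑ k : Fin n, if k < l then c else 0) = n.choose 2 * c
  | 0, c => by simp
  | n + 1, c => by
    rw [Fin.sum_univ_castSucc]
    have h1 : (∑ l : Fin n, ∑ k : Fin (n + 1), if k < l.castSucc then c else 0) =
        ∑ l : Fin n, ∑ k : Fin n, if k < l then c else 0 := by
      refine Finset.sum_congr rfl fun l _ ↦ ?_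
      rw [Fin.sum_univ_castSucc, if_neg (lt_asymm (Fin.castSucc_lt_last l)), Nat.add_zero]
      refine Finset.sum_congr rfl fun k _ ↦ ?_
      simp only [Fin.castSucc_lt_castSucc_iff]
    have h2 : (∑ k : Fin (n + 1), if k < Fin.last n then c else 0) = n * c := by
      rw [Fin.sum_univ_castSucc, if_neg (lt_irrefl _), Nat.add_zero]
      have : (∑ k : Fin n, if k.castSucc < Fin.last n then c else 0) = ∑ _k : Fin n, c :=
        Finset.sum_congr rfl fun k _ ↦ if_pos (Fin.castSucc_lt_last k)
      rw [this, Finset.sum_const, Finset.card_univ, Fintype.card_fin, smul_eq_mul]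
    rw [h1, h2, sum_sum_ite_lt_const n c, Nat.choose_succ_succ n 1, Nat.choose_one_right]
    ring

/-- **Hulek–Laface 2019, Prop. 2.4 (Murty) in type-free form: `ρ(Xᵏ) = k·ρ(X) + C(k,2)·dim_ℚ End_ℚ(X)` for
every abelian variety `X` and every `k`** — the additivity with cross terms
`ρ(∏ X_i) = Σ ρ(X_i) + Σ_{i<j} dim_ℚ Hom_ℚ(X_i, X_j)` (Prop. 2.2 / Cor. 2.3, `finrank_neronSeveriGroup_pi`) on
the constant family, `Hom_ℚ(X, X) = End_ℚ(X)`.  With Murty's values `ρ(X) = e, 3e, e, ½ ed²` and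
`[F : ℚ] = e, 4e, 4e, ed²` this is the printed table `½ ek(k+1)`, `ek(2k+1)`, `ek(2k−1)`, `½ ed²k²`.
[cite: HulekLaface2019PicardNumbersAV, §2.2 Prop. 2.4 with §2.1 Prop. 2.2 / Cor. 2.3] -/
theorem IsAbelianVariety.finrank_neronSeveriGroup_pow {Φ : (ι → ℝ) ≃L[ℝ] E} (hX : IsAbelianVariety Φ) (k : ℕ) :
    finrank ℤ (neronSeveriGroup (powPeriod Φ k)) =
      k * finrank ℤ (neronSeveriGroup Φ) + k.choose 2 * finrank ℚ (endAlgRat Φ) := by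
  rw [← piPeriod_const (n := k) Φ, finrank_neronSeveriGroup_pi (fun _ : Fin k ↦ Φ) (fun _ ↦ hX),
    Finset.sum_const, Finset.card_univ, Fintype.card_fin, smul_eq_mul]
  simp only [finrank_homRat_self]
  rw [sum_sum_ite_lt_const]

end Pow

/-! ## §3 Simple factors: `ρ(X) ≤ 2 dim X`, `ρ(X) < (dim X)²` (`dim X ≥ 2`), and the power bound -/

section Simple

variable {ι : Type*} [Fintype ι] [DecidableEq ι] [Nonempty ι] {E : Type*} [NormedAddCommGroup E]
  [NormedSpace ℂ E] {Φ : (ι → ℝ) ≃L[ℝ] E}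

/-- **`ρ(X) ≤ dim_ℚ End_ℚ(X) ≤ 2 dim X` for a simple abelian variety `X`** (of positive dimension):
`End_ℚ(X)` is a skew field over which `Λ ⊗ ℚ ≅ ℚ^{2g}` is a vector space, so `[End_ℚ(X) : ℚ] ∣ 2g`.
[cite: Lange2023AbelianVarietiesComplex, §2.6.1, p. 139 and §5.2 Prop. 5.2.1 (a)] -/
theorem IsSimple.finrank_neronSeveriGroup_le_two_mul_finrank (hX : IsSimple Φ) (hA : IsAbelianVariety Φ) :
    finrank ℤ (neronSeveriGroup Φ) ≤ 2 * finrank ℂ E := by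
  haveI : FiniteDimensional ℂ E := finiteDimensional_complex_of_period Φ
  calc finrank ℤ (neronSeveriGroup Φ) ≤ finrank ℚ (endAlgRat Φ) := hA.finrank_neronSeveriGroup_le_finrank_endAlgRat
    _ ≤ Fintype.card ι := hX.finrank_endAlgRat_le_card
    _ = 2 * finrank ℂ E := card_eq_two_mul_finrank Φ

/-- **A simple complex torus of dimension `g ≥ 2` has `ρ(X) < g²`**: `ρ(X) = g²` forces `X ∼ E_θ^g` with a CM
curve `E_θ` (Lange 2023 §2.6.3 Exercise (2), the tree's
`finrank_neronSeveriGroup_eq_sq_iff_exists_isIsogenous_ellipticPow_cm`), and then Poincaré uniqueness for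
the decompositions `X¹` and `E_θ^g` gives `1 = g` (`IsSimple.isIsogenous_ellipticPeriod_of_pow`).
[cite: HulekLaface2019PicardNumbersAV, §4 Thm. 4.1] [cite: Lange2023AbelianVarietiesComplex, §2.6.3 Exercise (2) and §2.4.4 Thm. 2.4.25] -/
theorem IsSimple.finrank_neronSeveriGroup_lt_sq (hX : IsSimple Φ) (hg : 2 ≤ finrank ℂ E) :
    finrank ℤ (neronSeveriGroup Φ) < finrank ℂ E ^ 2 := by
  haveI : FiniteDimensional ℂ E := finiteDimensional_complex_of_period Φ
  refine lt_of_le_of_ne (finrank_neronSeveriGroup_le_sq Φ) fun h ↦ ?_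
  obtain ⟨θ, hθ, -, hiso⟩ := (finrank_neronSeveriGroup_eq_sq_iff_exists_isIsogenous_ellipticPow_cm Φ hg).1 h
  have h1 : IsIsogenous (powPeriod Φ 1) (powPeriod (ellipticPeriod hθ) (finrank ℂ E)) :=
    IsIsogenous.trans _ _ _ (isIsomorphic_powPeriod_one Φ).symm.isIsogenous hiso
  have := (hX.isIsogenous_ellipticPeriod_of_pow one_pos (by omega) hθ h1).2
  omega

/-- `ρ(X) + 1 ≤ (dim X)²` for a simple torus of dimension `≥ 2` (the previous statement in `ℕ`-friendly form).
[cite: HulekLaface2019PicardNumbersAV, §4 Thm. 4.1] -/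
theorem IsSimple.finrank_neronSeveriGroup_succ_le_sq (hX : IsSimple Φ) (hg : 2 ≤ finrank ℂ E) :
    finrank ℤ (neronSeveriGroup Φ) + 1 ≤ finrank ℂ E ^ 2 :=
  hX.finrank_neronSeveriGroup_lt_sq hg

/-- **The type-free replacement of Cor. 2.5: `ρ(Xᵏ) ≤ k·ρ(X) + C(k,2)·(2 dim X)` for a simple abelian variety
`X`** (Prop. 2.4 type-free with `[End_ℚ(X) : ℚ] ≤ 2 dim X`).  Together with `ρ(X) ≤ 2 dim X` and
`ρ(X) ≤ (dim X)² − 1` this gives `ρ(Xᵏ) ≤ k · min(2n, n²−1) + k(k−1) n`, used below in place of the printed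
`½ nk(2k+1)`. [cite: HulekLaface2019PicardNumbersAV, §2.2 Prop. 2.4 / Cor. 2.5] [cite: Lange2023AbelianVarietiesComplex, §2.6.1, p. 139] -/
theorem IsSimple.finrank_neronSeveriGroup_pow_le (hX : IsSimple Φ) (hA : IsAbelianVariety Φ) (k : ℕ) :
    finrank ℤ (neronSeveriGroup (powPeriod Φ k)) ≤
      k * finrank ℤ (neronSeveriGroup Φ) + k.choose 2 * (2 * finrank ℂ E) := by
  haveI : FiniteDimensional ℂ E := finiteDimensional_complex_of_period Φ
  rw [hA.finrank_neronSeveriGroup_pow k]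
  have hf : finrank ℚ (endAlgRat Φ) ≤ 2 * finrank ℂ E :=
    hX.finrank_endAlgRat_le_card.trans_eq (card_eq_two_mul_finrank Φ)
  exact Nat.add_le_add_left (Nat.mul_le_mul_left _ hf) _

end Simple

/-! ## §4 The arithmetic of §3.2 (b), §3.3 and §4 with the type-free bound

Throughout `b = dim B ≥ 2`, `k = m + 1 ≥ 1` is the exponent, `p = ρ(B)` with `p ≤ 2b` and `p + 1 ≤ b²`, and
the bound of §3 reads `ρ(Bᵏ) ≤ (m+1) p + C(m+1, 2)·(2b)`. -/

section Arithmetic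

/-- `2 · C(m+1, 2) = (m+1) m`. [folklore] -/
private theorem two_mul_choose_succ_two : ∀ m : ℕ, 2 * (m + 1).choose 2 = (m + 1) * m
  | 0 => by decide
  | m + 1 => by
    have ih := two_mul_choose_succ_two m
    rw [Nat.choose_succ_succ (m + 1) 1, Nat.choose_one_right, mul_add, ih]
    ring

/-- **The type-free bound in closed form: `k p + C(k,2)·2b ≤ b k(k+1)`** for `p ≤ 2b` (`k = m+1`; compare
Cor. 2.5's `½ bk(2k+1) = bk² + ½ bk`, smaller by `½ bk`). [cite: HulekLaface2019PicardNumbersAV, §2.2 Cor. 2.5] -/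
theorem pow_bound_le_mul (b m p : ℕ) (hp : p ≤ 2 * b) :
    (m + 1) * p + (m + 1).choose 2 * (2 * b) ≤ b * (m + 1) * (m + 2) := by
  have h2 := two_mul_choose_succ_two m
  have hpf : (m + 1) * p ≤ (m + 1) * (2 * b) := Nat.mul_le_mul_left _ hp
  have hC : (m + 1).choose 2 * (2 * b) = b * ((m + 1) * m) := by
    rw [← h2]; ring
  rw [hC]
  nlinarith [hpf]

/-- **§3.2 (b) / §4, the case `A ∼ Bᵏ` with `b = dim B ≥ 2` and `g = bk ≥ 5`: `ρ(Bᵏ) ≤ (g−1)²`** (so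
`ρ(A) < (g−1)² + 1`; the paper: "`ρ(Bᵏ) ≤ ½ g(2k+1) ≤ ½ g(g+1)`" and "`½ g(g+1) ≤ (g−1)² + 1` holds for
`g ≥ 4`" — with the type-free bound the value `g = 4` is the boundary case treated next).
[cite: HulekLaface2019PicardNumbersAV, §3.2 (b) and §4 Thm. 4.2 (proof of (1))] -/
theorem pow_bound_le_sq_pred {b m p : ℕ} (hb : 2 ≤ b) (hp : p ≤ 2 * b) (h5 : 5 ≤ b * (m + 1)) :
    (m + 1) * p + (m + 1).choose 2 * (2 * b) ≤ (b * (m + 1) - 1) ^ 2 := by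
  refine (pow_bound_le_mul b m p hp).trans ?_
  obtain ⟨c, hc⟩ : ∃ c, b * (m + 1) = c + 5 := ⟨b * (m + 1) - 5, by omega⟩
  rw [hc, show c + 5 - 1 = c + 4 by omega]
  have hm2 : 2 * (m + 1) ≤ c + 5 := by rw [← hc]; exact Nat.mul_le_mul_right _ hb
  rcases Nat.lt_or_ge m 2 with hm | hm
  · interval_cases m <;> nlinarith
  · have h7 : 2 * (m + 2) ≤ c + 7 := by omega
    have h' : 2 * ((c + 5) * (m + 2)) ≤ (c + 5) * (c + 7) := by
      rw [mul_left_comm]; exact Nat.mul_le_mul_left _ h7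
    have hc1 : 1 ≤ c := by omega
    nlinarith

/-- **§3.2 (b), the case `A ∼ Bᵏ` with `b = dim B ≥ 2` and `g = bk ≥ 4`: `ρ(Bᵏ) ≤ (g−1)² + 1`** (for `g = 4`
the two shapes are `B²` with `B` a simple surface — `ρ(B²) = 2ρ(B) + [F:ℚ] ≤ 2·3 + 4 = 10 = 3² + 1`, using
`ρ(B) ≤ 3` — and a simple fourfold, `ρ(B) ≤ 8`).
[cite: HulekLaface2019PicardNumbersAV, §3.2 (b)] -/
theorem pow_bound_le_sq_pred_add_one {b m p : ℕ} (hb : 2 ≤ b) (hp : p ≤ 2 * b) (hp' : p + 1 ≤ b ^ 2)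
    (h4 : 4 ≤ b * (m + 1)) :
    (m + 1) * p + (m + 1).choose 2 * (2 * b) ≤ (b * (m + 1) - 1) ^ 2 + 1 := by
  rcases Nat.lt_or_ge (b * (m + 1)) 5 with h5 | h5
  · have h4' : b * (m + 1) = 4 := by omega
    have hm : m ≤ 1 := by nlinarith
    interval_cases m
    · have hb4 : b = 4 := by omega
      subst hb4
      simp
      omega
    · have hb2 : b = 2 := by omega
      subst hb2
      simp
      omega
  · exact (pow_bound_le_sq_pred hb hp h5).trans (Nat.le_succ _)

/-- **§3.3 (`r(A) = 1`, `b > 1`) / §4 Thm. 4.2 (2): `A ∼ Bᵏ` with `b = dim B ≥ 2` and `g = bk ≥ 7` has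
`ρ(Bᵏ) ≤ (g−2)² + 3 < (g−2)² + 4`** ("If `b > 1`, then `k ≤ g/2` and thus, by Corollary 2.5,
`ρ(Bᵏ) ≤ ½ g(2k+1) ≤ ½ g(g+1) ≤ (g−2)² + 4` again because `g ≥ 7`"; with the type-free bound the shape
`B⁴`, `dim B = 2` at `g = 8` uses `ρ(B) ≤ 3`: `4·3 + 6·4 = 36 ≤ 39`).
[cite: HulekLaface2019PicardNumbersAV, §3.3 (case `r(A) = 1`, `b > 1`) and §4 Thm. 4.2 (proof of (2))] -/
theorem pow_bound_le_sq_sub_two_add_three {b m p : ℕ} (hb : 2 ≤ b) (hp : p ≤ 2 * b) (hp' : p + 1 ≤ b ^ 2)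
    (h7 : 7 ≤ b * (m + 1)) :
    (m + 1) * p + (m + 1).choose 2 * (2 * b) ≤ (b * (m + 1) - 2) ^ 2 + 3 := by
  obtain ⟨c, hc⟩ : ∃ c, b * (m + 1) = c + 7 := ⟨b * (m + 1) - 7, by omega⟩
  have hT := pow_bound_le_mul b m p hp
  rw [hc, show c + 7 - 2 = c + 5 by omega]
  have hT' : b * (m + 1) * (m + 2) = (c + 7) * (m + 2) := by rw [← hc]
  have hm2 : 2 * (m + 1) ≤ c + 7 := by rw [← hc]; exact Nat.mul_le_mul_right _ hb
  rcases Nat.lt_or_ge m 4 with hm | hm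
  · interval_cases m
    · -- `k = 1`: `ρ(B) ≤ 2b = 2g`
      nlinarith
    · -- `k = 2`: `≤ 6b = 3g`
      nlinarith
    · -- `k = 3`: `≤ 12b = 4g`
      nlinarith
    · -- `k = 4`: `b = 2` (`g = 8`) needs `ρ(B) ≤ 3`; `b ≥ 3`: `≤ 20b = 5g`
      rcases hb.eq_or_lt with rfl | hb3
      · have hc1 : c = 1 := by omega
        subst hc1
        have : (3 + 1).choose 2 = 6 := by decide
        rw [this]
        omega
      · have hc5 : 5 ≤ c := by omega
        nlinarith
  · -- `k ≥ 5`: `b k (k+1) ≤ ½ g (g+2) ≤ (g−2)² + 3`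
    have h9 : 2 * (m + 2) ≤ c + 9 := by omega
    have h' : 2 * ((c + 7) * (m + 2)) ≤ (c + 7) * (c + 9) := by
      rw [mul_left_comm]; exact Nat.mul_le_mul_left _ h9
    have hc3 : 3 ≤ c := by omega
    nlinarith

/-- **§3.3 Step 2 / §4 (b): `A ∼ Eˣ × Bʸ` with `E` an elliptic curve, `b = dim B ≥ 2`, `x, y ≥ 1`,
`g = x + by`: `ρ(Eˣ) + ρ(Bʸ) ≤ (g−2)² + 3 < (g−2)² + 4`** ("`ρ(Eᵏ × Aˡ) ≤ k² + ½ al(2l+1)` […] Its maximum is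
at `y_max = 1`, with value `g(y_max) = (g−2)² + 3 < (g−2)² + 4`"; with the type-free bound the maximum is
again at `y = 1`, `b = 2` — `x² + ρ(B) ≤ x² + 3` for a simple surface `B`).  Here `P = ρ(Eˣ) ≤ x²`,
`p = ρ(B)`, `y = m + 1`. [cite: HulekLaface2019PicardNumbersAV, §3.3 Step 2 and §4 Thm. 4.2 (proof, (b))] -/
theorem step_two_bound {x b m P p : ℕ} (hx : 1 ≤ x) (hb : 2 ≤ b) (hP : P ≤ x ^ 2) (hp : p ≤ 2 * b)
    (hp' : p + 1 ≤ b ^ 2) :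
    P + ((m + 1) * p + (m + 1).choose 2 * (2 * b)) ≤ (x + b * (m + 1) - 2) ^ 2 + 3 := by
  obtain ⟨x, rfl⟩ : ∃ x', x = x' + 1 := ⟨x - 1, by omega⟩
  rcases Nat.eq_zero_or_pos m with rfl | hm
  · -- `y = 1`: `ρ(Eˣ × B) ≤ x² + ρ(B)`
    simp only [Nat.zero_add, one_mul, mul_one, show Nat.choose 1 2 = 0 by decide, zero_mul, add_zero]
    rcases hb.eq_or_lt with rfl | hb3
    · -- `B` a simple surface: `ρ(B) ≤ 3`
      rw [show x + 1 + 2 - 2 = x + 1 by omega]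
      omega
    · obtain ⟨d, rfl⟩ : ∃ d, b = d + 3 := ⟨b - 3, by omega⟩
      rw [show x + 1 + (d + 3) - 2 = x + d + 2 by omega]
      nlinarith
  · -- `y ≥ 2`
    obtain ⟨m, rfl⟩ : ∃ m', m = m' + 1 := ⟨m - 1, by omega⟩
    have hT := pow_bound_le_mul b (m + 1) p hp
    -- `u = b y ≥ 4`
    obtain ⟨v, hv⟩ : ∃ v, b * (m + 1 + 1) = v + 4 := ⟨b * (m + 2) - 4, by
      have : 2 * (m + 2) ≤ b * (m + 2) := Nat.mul_le_mul_right _ hb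
      rw [show m + 1 + 1 = m + 2 by rfl]; omega⟩
    rw [hv, show x + 1 + (v + 4) - 2 = x + v + 3 by omega]
    by_cases hbm : b = 2 ∧ m = 0
    · -- `E^x × B²`, `B` a simple surface: `2ρ(B) + [F:ℚ] ≤ 10`
      obtain ⟨rfl, rfl⟩ := hbm
      have hv0 : v = 0 := by omega
      subst hv0
      have : (0 + 1 + 1).choose 2 = 1 := by decide
      rw [this]
      nlinarith
    · -- otherwise `y + 3 ≤ b y = u`, so `b y (y+1) ≤ u (u−2)`
      have hmv : m + 1 ≤ v := by
        rcases hb.eq_or_lt with rfl | hb3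
        · have hm0 : m ≠ 0 := fun h ↦ hbm ⟨rfl, h⟩
          omega
        · have : 3 * (m + 1 + 1) ≤ b * (m + 1 + 1) := Nat.mul_le_mul_right _ hb3
          omega
      have hT' : b * (m + 1 + 1) * (m + 1 + 2) = (v + 4) * (m + 3) := by rw [hv]
      have hkey : (v + 4) * (m + 3) ≤ (v + 4) * (v + 2) := Nat.mul_le_mul_left _ (by omega)
      nlinarith

/-- **§3.3 Step 3 / §4 (a): `A ∼ Aᵏ × Bˡ` with `a = dim A ≥ 2`, `b = dim B ≥ 2`, `k, l ≥ 1`,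
`g = ak + bl ≥ 6`: `ρ(Aᵏ) + ρ(Bˡ) ≤ (g−2)² + 3 < (g−2)² + 4`** ("`ρ(Aᵏ × Bˡ) ≤ ½ ak(2k+1) + ½ bl(2l+1) ≤
½ g(2k+1) ≤ ½ g(g−1) < (g−2)² + 4`"; with the type-free bound: `≤ ak(k+1) + bl(l+1) ≤ g(max(k,l)+1) ≤ ½ g²
≤ (g−2)² + 3` for `g ≥ 6`).  Here `k = m+1`, `l = m'+1`, `p = ρ(A)`, `q = ρ(B)`.
[cite: HulekLaface2019PicardNumbersAV, §3.3 Step 3 and §4 Thm. 4.2 (proof, (a))] -/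
theorem step_three_bound {a b m m' p q : ℕ} (ha : 2 ≤ a) (hb : 2 ≤ b) (hp : p ≤ 2 * a) (hq : q ≤ 2 * b)
    (hg : 6 ≤ a * (m + 1) + b * (m' + 1)) :
    ((m + 1) * p + (m + 1).choose 2 * (2 * a)) + ((m' + 1) * q + (m' + 1).choose 2 * (2 * b)) ≤
      (a * (m + 1) + b * (m' + 1) - 2) ^ 2 + 3 := by
  have hA := pow_bound_le_mul a m p hp
  have hB := pow_bound_le_mul b m' q hq
  obtain ⟨c, hc⟩ : ∃ c, a * (m + 1) + b * (m' + 1) = c + 6 := ⟨a * (m + 1) + b * (m' + 1) - 6, by omega⟩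
  rw [hc, show c + 6 - 2 = c + 4 by omega]
  -- the symmetric bound `a k(k+1) + b l(l+1) ≤ g · (max(k,l) + 1)` and `2 (max + 1) ≤ g`
  have ham : 2 * (m + 1) ≤ a * (m + 1) := Nat.mul_le_mul_right _ ha
  have hbm : 2 * (m' + 1) ≤ b * (m' + 1) := Nat.mul_le_mul_right _ hb
  rcases le_total m' m with hmm | hmm
  · have h1 : b * (m' + 1) * (m' + 2) ≤ b * (m' + 1) * (m + 2) := Nat.mul_le_mul_left _ (by omega)
    have h2 : a * (m + 1) * (m + 2) + b * (m' + 1) * (m + 2) = (c + 6) * (m + 2) := by rw [← hc]; ring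
    have h3 : 2 * (m + 2) ≤ c + 6 := by omega
    have h4 : 2 * ((c + 6) * (m + 2)) ≤ (c + 6) * (c + 6) := by
      rw [mul_left_comm]; exact Nat.mul_le_mul_left _ h3
    nlinarith
  · have h1 : a * (m + 1) * (m + 2) ≤ a * (m + 1) * (m' + 2) := Nat.mul_le_mul_left _ (by omega)
    have h2 : a * (m + 1) * (m' + 2) + b * (m' + 1) * (m' + 2) = (c + 6) * (m' + 2) := by rw [← hc]; ring
    have h3 : 2 * (m' + 2) ≤ c + 6 := by omega
    have h4 : 2 * ((c + 6) * (m' + 2)) ≤ (c + 6) * (c + 6) := by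
      rw [mul_left_comm]; exact Nat.mul_le_mul_left _ h3
    nlinarith

end Arithmetic

/-! ## §5 Along a Poincaré decomposition `A ∼ ∏_ν X_ν^{n_ν}`: the cases with a factor of dimension `≥ 2` -/

section Pair

variable {ρ : Type*} [Fintype ρ] [DecidableEq ρ]

/-- An index set with two elements. [folklore] -/
private theorem exists_pair_univ_of_card_eq_two (h : Fintype.card ρ = 2) :
    ∃ x y : ρ, x ≠ y ∧ (Finset.univ : Finset ρ) = {x, y} := by
  obtain ⟨x, y, hxy, hu⟩ := Finset.card_eq_two.1 ((Finset.card_univ (α := ρ)).trans h)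
  exact ⟨x, y, hxy, hu⟩

end Pair

section Decomposition

variable {ι : Type*} [Fintype ι] [DecidableEq ι] {E : Type*} [NormedAddCommGroup E] [NormedSpace ℂ E]
  {ρ : Type*} [Fintype ρ] [DecidableEq ρ] {τ : ρ → Type*} [∀ ν, Fintype (τ ν)] [∀ ν, DecidableEq (τ ν)]
  [∀ ν, Nonempty (τ ν)]
  {G : ρ → Type*} [∀ ν, NormedAddCommGroup (G ν)] [∀ ν, NormedSpace ℂ (G ν)]
  (X : ∀ ν, (τ ν → ℝ) ≃L[ℝ] G ν) (n : ρ → ℕ)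

omit [DecidableEq ρ] in
/-- **§3.2 (b), §3.3 (`r(A) = 1`, `b > 1`) and §4 for `A ∼ Bᵏ` with ONE simple factor `B = X_{ν₀}` of
dimension `b ≥ 2`** (`g = bk`): `g ≥ 4 ⟹ ρ(A) ≤ (g−1)² + 1`; `g ≥ 5 ⟹ ρ(A) ≤ (g−1)²` (so `ρ(A) ≠ (g−1)² + 1`,
Thm. 4.2 (1)); `g ≥ 7 ⟹ ρ(A) ≤ (g−2)² + 3` (Thm. 1.1 (2) and Thm. 4.2 (2)).  Printed: "by Corollary 2.5 we
have `ρ(Bᵏ) ≤ ½ g(2k+1) ≤ ½ g(g+1)` and the claim follows"; here through `ρ(Bᵏ) ≤ k ρ(B) + C(k,2)·2b`,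
`ρ(B) ≤ 2b`, `ρ(B) ≤ b² − 1` (§3) and §4.
[cite: HulekLaface2019PicardNumbersAV, §3.2 (b), §3.3 (case `r(A) = 1`) and §4 Thm. 4.2 (proof)] -/
theorem IsIsogenous.finrank_neronSeveriGroup_bounds_of_card_eq_one {A : (ι → ℝ) ≃L[ℝ] E}
    (hiso : IsIsogenous A (sigmaPiPeriod fun ν ↦ powPeriod (X ν) (n ν))) (hX : ∀ ν, IsSimple (X ν))
    (hA : ∀ ν, IsAbelianVariety (X ν)) (hn : ∀ ν, 0 < n ν) (h1 : Fintype.card ρ = 1)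
    (hb : ∃ ν, finrank ℂ (G ν) ≠ 1) :
    (4 ≤ finrank ℂ E → finrank ℤ (neronSeveriGroup A) ≤ (finrank ℂ E - 1) ^ 2 + 1) ∧
      (5 ≤ finrank ℂ E → finrank ℤ (neronSeveriGroup A) ≤ (finrank ℂ E - 1) ^ 2) ∧
      (7 ≤ finrank ℂ E → finrank ℤ (neronSeveriGroup A) ≤ (finrank ℂ E - 2) ^ 2 + 3) := by
  obtain ⟨ν₀, huniq⟩ := Fintype.card_eq_one_iff.1 h1
  letI : Unique ρ := { default := ν₀, uniq := huniq }
  haveI : FiniteDimensional ℂ (G ν₀) := finiteDimensional_complex_of_period (X ν₀)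
  obtain ⟨ν, hν⟩ := hb
  have hν₀ : finrank ℂ (G ν₀) ≠ 1 := huniq ν ▸ hν
  have hAX : IsIsogenous A (powPeriod (X ν₀) (n ν₀)) :=
    IsIsogenous.trans _ _ _ hiso (isIsomorphic_sigmaPiPeriod_unique fun ν ↦ powPeriod (X ν) (n ν)).isIsogenous
  have hb1 : 0 < finrank ℂ (G ν₀) := finrank_pos_of_nonempty (X ν₀)
  have hb2 : 2 ≤ finrank ℂ (G ν₀) := by omega
  obtain ⟨m, hm⟩ : ∃ m, n ν₀ = m + 1 := ⟨n ν₀ - 1, by have := hn ν₀; omega⟩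
  have hg : finrank ℂ E = finrank ℂ (G ν₀) * (m + 1) := by
    rw [hAX.finrank_eq _ _, finrank_fin_fun, hm, mul_comm]
  have hρ : finrank ℤ (neronSeveriGroup A) ≤
      (m + 1) * finrank ℤ (neronSeveriGroup (X ν₀)) + (m + 1).choose 2 * (2 * finrank ℂ (G ν₀)) := by
    rw [hAX.finrank_neronSeveriGroup_eq _ _, hm]
    exact (hX ν₀).finrank_neronSeveriGroup_pow_le (hA ν₀) (m + 1)
  have hp : finrank ℤ (neronSeveriGroup (X ν₀)) ≤ 2 * finrank ℂ (G ν₀) :=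
    (hX ν₀).finrank_neronSeveriGroup_le_two_mul_finrank (hA ν₀)
  have hp' : finrank ℤ (neronSeveriGroup (X ν₀)) + 1 ≤ finrank ℂ (G ν₀) ^ 2 :=
    (hX ν₀).finrank_neronSeveriGroup_succ_le_sq hb2
  rw [hg]
  exact ⟨fun h4 ↦ hρ.trans (pow_bound_le_sq_pred_add_one hb2 hp hp' h4),
    fun h5 ↦ hρ.trans (pow_bound_le_sq_pred hb2 hp h5),
    fun h7 ↦ hρ.trans (pow_bound_le_sq_sub_two_add_three hb2 hp hp' h7)⟩

/-- **§3.3 Steps 2–3 and §4 (a)–(b) for `A ∼ X_x^{n_x} × X_y^{n_y}` (`r(A) = 2`) with at least one simple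
factor of dimension `≥ 2`** (`g ≥ 6`): `ρ(A) = ρ(X_x^{n_x}) + ρ(X_y^{n_y}) ≤ (g−2)² + 3 < (g−2)² + 4`
(Cor. 2.3 for the two non-isogenous isotypic factors; `ρ(Eᵏ) ≤ k²` for an elliptic factor; `step_two_bound`
/ `step_three_bound`). [cite: HulekLaface2019PicardNumbersAV, §3.3 Steps 2–3 and §4 Thm. 4.2 (proof, (a)–(b))] -/
theorem IsIsogenous.finrank_neronSeveriGroup_le_of_card_eq_two {A : (ι → ℝ) ≃L[ℝ] E}
    (hiso : IsIsogenous A (sigmaPiPeriod fun ν ↦ powPeriod (X ν) (n ν))) (hX : ∀ ν, IsSimple (X ν))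
    (hA : ∀ ν, IsAbelianVariety (X ν)) (hXX : ∀ ν ν', ν ≠ ν' → ¬ IsIsogenous (X ν) (X ν'))
    (hn : ∀ ν, 0 < n ν) (h2 : Fintype.card ρ = 2) (hb : ∃ ν, finrank ℂ (G ν) ≠ 1)
    (hg : 6 ≤ finrank ℂ E) :
    finrank ℤ (neronSeveriGroup A) ≤ (finrank ℂ E - 2) ^ 2 + 3 := by
  haveI : ∀ ν, FiniteDimensional ℂ (G ν) := fun ν ↦ finiteDimensional_complex_of_period (X ν)
  obtain ⟨x, y, hxy, hu⟩ := exists_pair_univ_of_card_eq_two h2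
  have hmem : ∀ ν : ρ, ν = x ∨ ν = y := fun ν ↦ by
    have h := Finset.mem_univ ν
    rw [hu, Finset.mem_insert, Finset.mem_singleton] at h
    exact h
  have hgE : finrank ℂ E = n x * finrank ℂ (G x) + n y * finrank ℂ (G y) := by
    rw [hiso.finrank_eq _ _, finrank_powers_eq X n, hu, Finset.sum_pair (f := fun ν ↦ n ν * finrank ℂ (G ν)) hxy]
  have hρA : finrank ℤ (neronSeveriGroup A) =
      finrank ℤ (neronSeveriGroup (powPeriod (X x) (n x))) +
        finrank ℤ (neronSeveriGroup (powPeriod (X y) (n y))) := by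
    rw [hiso.finrank_neronSeveriGroup_eq _ _, finrank_neronSeveriGroup_powers_of_univ_eq_pair X n hX hA hXX hxy hu]
  have hdim : ∀ ν, 0 < finrank ℂ (G ν) := fun ν ↦ finrank_pos_of_nonempty (X ν)
  have hpow : ∀ ν, finrank ℤ (neronSeveriGroup (powPeriod (X ν) (n ν))) ≤ (n ν * finrank ℂ (G ν)) ^ 2 :=
    fun ν ↦ finrank_neronSeveriGroup_powPeriod_le_sq (X ν) (n ν)
  have hpow' : ∀ ν, finrank ℤ (neronSeveriGroup (powPeriod (X ν) (n ν))) ≤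
      n ν * finrank ℤ (neronSeveriGroup (X ν)) + (n ν).choose 2 * (2 * finrank ℂ (G ν)) :=
    fun ν ↦ (hX ν).finrank_neronSeveriGroup_pow_le (hA ν) (n ν)
  have hp : ∀ ν, finrank ℤ (neronSeveriGroup (X ν)) ≤ 2 * finrank ℂ (G ν) :=
    fun ν ↦ (hX ν).finrank_neronSeveriGroup_le_two_mul_finrank (hA ν)
  have hp' : ∀ ν, 2 ≤ finrank ℂ (G ν) → finrank ℤ (neronSeveriGroup (X ν)) + 1 ≤ finrank ℂ (G ν) ^ 2 :=
    fun ν h ↦ (hX ν).finrank_neronSeveriGroup_succ_le_sq h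
  obtain ⟨mx, hmx⟩ : ∃ m, n x = m + 1 := ⟨n x - 1, by have := hn x; omega⟩
  obtain ⟨my, hmy⟩ : ∃ m, n y = m + 1 := ⟨n y - 1, by have := hn y; omega⟩
  have hx' := hpow' x
  have hy' := hpow' y
  rw [hmx] at hx'
  rw [hmy] at hy'
  rw [hgE] at hg ⊢
  rw [hρA]
  rcases Nat.lt_or_ge (finrank ℂ (G x)) 2 with hx1 | hx2 <;>
    rcases Nat.lt_or_ge (finrank ℂ (G y)) 2 with hy1 | hy2
  · -- both factors elliptic: excluded by `hb`
    exfalso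
    obtain ⟨ν, hν⟩ := hb
    rcases hmem ν with rfl | rfl
    · have := hdim ν; omega
    · have := hdim ν; omega
  · -- `X_x` elliptic, `dim X_y ≥ 2`: Step 2
    have hdx : finrank ℂ (G x) = 1 := by have := hdim x; omega
    have hPx : finrank ℤ (neronSeveriGroup (powPeriod (X x) (n x))) ≤ n x ^ 2 := by
      simpa [hdx] using hpow x
    have key := step_two_bound (m := my) (hn x) hy2 hPx (hp y) (hp' y hy2)
    rw [hdx, mul_one, hmy, mul_comm (my + 1) (finrank ℂ (G y))]
    exact (Nat.add_le_add_left hy' _).trans key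
  · -- `dim X_x ≥ 2`, `X_y` elliptic: Step 2 with the factors exchanged
    have hdy : finrank ℂ (G y) = 1 := by have := hdim y; omega
    have hPy : finrank ℤ (neronSeveriGroup (powPeriod (X y) (n y))) ≤ n y ^ 2 := by
      simpa [hdy] using hpow y
    have key := step_two_bound (m := mx) (hn y) hx2 hPy (hp x) (hp' x hx2)
    rw [hdy, mul_one, hmx, mul_comm (mx + 1) (finrank ℂ (G x)), add_comm (finrank ℂ (G x) * (mx + 1)),
      add_comm (finrank ℤ (neronSeveriGroup (powPeriod (X x) (mx + 1))))]
    exact (Nat.add_le_add_left hx' _).trans key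
  · -- both of dimension `≥ 2`: Step 3
    rw [hmx, hmy] at hg
    have key := step_three_bound (ha := hx2) (hb := hy2) (hp x) (hp y)
      (m := mx) (m' := my) (by linarith)
    rw [hmx, hmy, mul_comm (mx + 1), mul_comm (my + 1)]
    exact (Nat.add_le_add hx' hy').trans key

/-- **Hulek–Laface 2019, Thm. 1.1 (1) along a Poincaré decomposition, ALL cases** (`g ≥ 4`; simple,
nonzero, pairwise non-isogenous abelian varieties `X_ν`, `n_ν ≥ 1`, `A ∼ ∏_ν X_ν^{n_ν}`):
`ρ(A) = g²` or `ρ(A) ≤ (g−1)² + 1` — the statement `IsIsogenous.finrank_neronSeveriGroup_eq_sq_or_le_of_powers`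
of `ComplexTorusPicardNumberPoincareLength.lean` with its hypothesis `hMurty` removed (case (b), `m ≥ 2`, is
`IsIsogenous.finrank_neronSeveriGroup_bounds_of_card_eq_one`).
[cite: HulekLaface2019PicardNumbersAV, Thm. 1.1 (1) and §3.2] -/
theorem IsIsogenous.finrank_neronSeveriGroup_eq_sq_or_le_of_powers' {A : (ι → ℝ) ≃L[ℝ] E}
    (hiso : IsIsogenous A (sigmaPiPeriod fun ν ↦ powPeriod (X ν) (n ν))) (hX : ∀ ν, IsSimple (X ν))
    (hA : ∀ ν, IsAbelianVariety (X ν)) (hXX : ∀ ν ν', ν ≠ ν' → ¬ IsIsogenous (X ν) (X ν'))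
    (hn : ∀ ν, 0 < n ν) (hg : 4 ≤ finrank ℂ E) :
    finrank ℤ (neronSeveriGroup A) = finrank ℂ E ^ 2 ∨
      finrank ℤ (neronSeveriGroup A) ≤ (finrank ℂ E - 1) ^ 2 + 1 := by
  by_cases hell : Fintype.card ρ = 1 → ∀ ν, finrank ℂ (G ν) = 1
  · exact hiso.finrank_neronSeveriGroup_eq_sq_or_le_of_powers X n hX hA hXX hn hg hell
  · push Not at hell
    obtain ⟨h1, ν, hν⟩ := hell
    exact Or.inr ((hiso.finrank_neronSeveriGroup_bounds_of_card_eq_one X n hX hA hn h1 ⟨ν, hν⟩).1 hg)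

/-- **Thm. 1.1 (1) in the printed form along a Poincaré decomposition, all cases: "there does not exist any
abelian variety of dimension `g` (`g ≥ 4`) with Picard number `ρ` in the range `(g−1)² + 1 < ρ < g²`".**
[cite: HulekLaface2019PicardNumbersAV, Thm. 1.1 (1)] -/
theorem IsIsogenous.not_lt_finrank_neronSeveriGroup_lt_of_powers' {A : (ι → ℝ) ≃L[ℝ] E}
    (hiso : IsIsogenous A (sigmaPiPeriod fun ν ↦ powPeriod (X ν) (n ν))) (hX : ∀ ν, IsSimple (X ν))
    (hA : ∀ ν, IsAbelianVariety (X ν)) (hXX : ∀ ν ν', ν ≠ ν' → ¬ IsIsogenous (X ν) (X ν'))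
    (hn : ∀ ν, 0 < n ν) (hg : 4 ≤ finrank ℂ E) :
    ¬ ((finrank ℂ E - 1) ^ 2 + 1 < finrank ℤ (neronSeveriGroup A) ∧
      finrank ℤ (neronSeveriGroup A) < finrank ℂ E ^ 2) := by
  rintro ⟨hlt, hlt'⟩
  rcases hiso.finrank_neronSeveriGroup_eq_sq_or_le_of_powers' X n hX hA hXX hn hg with h | h
  · exact absurd h hlt'.ne
  · exact absurd h (not_le.2 hlt)

/-- **Hulek–Laface 2019, Thm. 1.1 (2) along a Poincaré decomposition, ALL cases** (`g ≥ 7`): the Picard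
number is not in the range `(g−2)² + 4 < ρ < (g−1)² + 1` — the statement
`IsIsogenous.not_lt_finrank_neronSeveriGroup_lt_secondGap_of_powers` of `ComplexTorusPicardNumberSecondGap.lean`
with its hypothesis `hell` removed: the cases `A ∼ Bᵏ` (`dim B ≥ 2`), `Eᵏ × Bˡ`, `Aᵏ × Bˡ` of §3.3 are
`IsIsogenous.finrank_neronSeveriGroup_bounds_of_card_eq_one` / `…_le_of_card_eq_two` (`ρ ≤ (g−2)² + 3`).
[cite: HulekLaface2019PicardNumbersAV, Thm. 1.1 (2) and §3.3] -/
theorem IsIsogenous.not_lt_finrank_neronSeveriGroup_lt_secondGap_of_powers' {A : (ι → ℝ) ≃L[ℝ] E}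
    (hiso : IsIsogenous A (sigmaPiPeriod fun ν ↦ powPeriod (X ν) (n ν))) (hX : ∀ ν, IsSimple (X ν))
    (hA : ∀ ν, IsAbelianVariety (X ν)) (hXX : ∀ ν ν', ν ≠ ν' → ¬ IsIsogenous (X ν) (X ν'))
    (hn : ∀ ν, 0 < n ν) (hg : 7 ≤ finrank ℂ E) :
    ¬ ((finrank ℂ E - 2) ^ 2 + 4 < finrank ℤ (neronSeveriGroup A) ∧
      finrank ℤ (neronSeveriGroup A) < (finrank ℂ E - 1) ^ 2 + 1) := by
  by_cases hell : Fintype.card ρ ≤ 2 → ∀ ν, finrank ℂ (G ν) = 1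
  · exact hiso.not_lt_finrank_neronSeveriGroup_lt_secondGap_of_powers X n hX hA hXX hn hg hell
  · push Not at hell
    obtain ⟨h2, ν, hν⟩ := hell
    rintro ⟨hlo, -⟩
    have hpos : 0 < Fintype.card ρ := Fintype.card_pos_iff.2 ⟨ν⟩
    rcases Nat.lt_or_ge (Fintype.card ρ) 2 with h1 | h2'
    · have := (hiso.finrank_neronSeveriGroup_bounds_of_card_eq_one X n hX hA hn (by omega) ⟨ν, hν⟩).2.2 hg
      omega
    · have := hiso.finrank_neronSeveriGroup_le_of_card_eq_two X n hX hA hXX hn (by omega) ⟨ν, hν⟩ (by omega)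
      omega

/-- **Hulek–Laface 2019, Thm. 4.2 (1) along a Poincaré decomposition, ALL cases** (`g ≥ 5`):
`ρ(A) = (g−1)² + 1` iff the decomposition has length `2`, all factors are elliptic curves, all exponents
but one (`n_{ν₀}`) equal `1`, and `X_{ν₀}` has complex multiplication ("`ρ(A) = (g−1)² + 1 ⟺
A ∼ E_1^{g−1} × E_2`, where `E_1` has complex multiplication and `E_1` and `E_2` are not isogeneous") — the
statement of `ComplexTorusPicardNumberSecondGap.lean` with `hell` removed: for `A ∼ Bᵏ`, `dim B ≥ 2`,
`ρ(A) ≤ (g−1)²` (`IsIsogenous.finrank_neronSeveriGroup_bounds_of_card_eq_one`).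
[cite: HulekLaface2019PicardNumbersAV, §4 Thm. 4.2 (1)] -/
theorem IsIsogenous.finrank_neronSeveriGroup_eq_sq_pred_add_one_iff_of_powers' [Nonempty ρ]
    {A : (ι → ℝ) ≃L[ℝ] E} (hiso : IsIsogenous A (sigmaPiPeriod fun ν ↦ powPeriod (X ν) (n ν)))
    (hX : ∀ ν, IsSimple (X ν)) (hA : ∀ ν, IsAbelianVariety (X ν))
    (hXX : ∀ ν ν', ν ≠ ν' → ¬ IsIsogenous (X ν) (X ν')) (hn : ∀ ν, 0 < n ν) (hg : 5 ≤ finrank ℂ E) :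
    finrank ℤ (neronSeveriGroup A) = (finrank ℂ E - 1) ^ 2 + 1 ↔
      Fintype.card ρ = 2 ∧ ∃ ν₀, (∀ ν, finrank ℂ (G ν) = 1) ∧ (∀ ν, ν ≠ ν₀ → n ν = 1) ∧
        finrank ℚ (endAlgRat (X ν₀)) = 2 := by
  by_cases hell : Fintype.card ρ = 1 → ∀ ν, finrank ℂ (G ν) = 1
  · exact hiso.finrank_neronSeveriGroup_eq_sq_pred_add_one_iff_of_powers X n hX hA hXX hn hg hell
  · push Not at hell
    obtain ⟨h1, ν, hν⟩ := hell
    have hlt := (hiso.finrank_neronSeveriGroup_bounds_of_card_eq_one X n hX hA hn h1 ⟨ν, hν⟩).2.1 hg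
    constructor
    · intro h
      exfalso
      omega
    · rintro ⟨h2, -⟩
      omega

/-- **Hulek–Laface 2019, Thm. 4.2 (2) along a Poincaré decomposition, ALL cases** (`g ≥ 7`):
`ρ(A) = (g−2)² + 4` iff the decomposition has length `2`, both factors are elliptic curves with complex
multiplication, and one exponent is `2` ("`ρ(A) = (g−2)² + 4 ⟺ A ∼ E_1^{g−2} × E_2²`, where `E_1` and
`E_2` both have complex multiplication but are not isogeneous") — the statement of
`ComplexTorusPicardNumberSecondGap.lean` with `hell` removed: in the cases `A ∼ Bᵏ` (`dim B ≥ 2`),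
`Eᵏ × Bˡ`, `Aᵏ × Bˡ` one has `ρ(A) ≤ (g−2)² + 3` (cases (a), (b) of the printed proof).
[cite: HulekLaface2019PicardNumbersAV, §4 Thm. 4.2 (2)] -/
theorem IsIsogenous.finrank_neronSeveriGroup_eq_sq_sub_two_add_four_iff_of_powers' [Nonempty ρ]
    {A : (ι → ℝ) ≃L[ℝ] E} (hiso : IsIsogenous A (sigmaPiPeriod fun ν ↦ powPeriod (X ν) (n ν)))
    (hX : ∀ ν, IsSimple (X ν)) (hA : ∀ ν, IsAbelianVariety (X ν))
    (hXX : ∀ ν ν', ν ≠ ν' → ¬ IsIsogenous (X ν) (X ν')) (hn : ∀ ν, 0 < n ν) (hg : 7 ≤ finrank ℂ E) :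
    finrank ℤ (neronSeveriGroup A) = (finrank ℂ E - 2) ^ 2 + 4 ↔
      Fintype.card ρ = 2 ∧ (∀ ν, finrank ℂ (G ν) = 1) ∧ (∀ ν, finrank ℚ (endAlgRat (X ν)) = 2) ∧
        ∃ ν, n ν = 2 := by
  by_cases hell : Fintype.card ρ ≤ 2 → ∀ ν, finrank ℂ (G ν) = 1
  · exact hiso.finrank_neronSeveriGroup_eq_sq_sub_two_add_four_iff_of_powers X n hX hA hXX hn hg hell
  · push Not at hell
    obtain ⟨h2, ν, hν⟩ := hell
    have hle : finrank ℤ (neronSeveriGroup A) ≤ (finrank ℂ E - 2) ^ 2 + 3 := by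
      rcases Nat.lt_or_ge (Fintype.card ρ) 2 with h1 | h2'
      · have h1' : Fintype.card ρ = 1 := le_antisymm (by omega) Fintype.card_pos
        exact (hiso.finrank_neronSeveriGroup_bounds_of_card_eq_one X n hX hA hn h1' ⟨ν, hν⟩).2.2 hg
      · exact hiso.finrank_neronSeveriGroup_le_of_card_eq_two X n hX hA hXX hn (by omega) ⟨ν, hν⟩ (by omega)
    constructor
    · intro h
      exfalso
      omega
    · rintro ⟨-, hd, -⟩
      exact absurd (hd ν) hν

end Decomposition

/-! ## §6 Thm. 1.1 for every abelian variety, hypothesis-free -/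

section Unconditional

variable {ι : Type*} [Fintype ι] [DecidableEq ι] {E : Type*} [NormedAddCommGroup E] [NormedSpace ℂ E]
  {A : (ι → ℝ) ≃L[ℝ] E}

/-- **For every abelian variety `A` of dimension `g ≥ 4`: `ρ(A) = g²` or `ρ(A) ≤ (g−1)² + 1`** (Thm. 1.1
(1) with Prop. 3.1's `M_{2,g}`), through a Poincaré decomposition `A ∼ ∏_ν X_ν^{n_ν}` with nonzero simple
pairwise non-isogenous abelian factors (`IsRiemannForm.exists_isIsogenous_powers_pos`, Thm. 2.4.25).
[cite: HulekLaface2019PicardNumbersAV, Thm. 1.1 (1) and §3.2] [cite: Lange2023AbelianVarietiesComplex, §2.4.4 Thm. 2.4.25] -/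
theorem IsAbelianVariety.finrank_neronSeveriGroup_eq_sq_or_le (hAV : IsAbelianVariety A) (hg : 4 ≤ finrank ℂ E) :
    finrank ℤ (neronSeveriGroup A) = finrank ℂ E ^ 2 ∨
      finrank ℤ (neronSeveriGroup A) ≤ (finrank ℂ E - 1) ^ 2 + 1 := by
  obtain ⟨ω, hω⟩ := hAV
  obtain ⟨r, V, hV, hVc, n, hVpos, hVs, hVab, hVV, hn, hiso⟩ := IsRiemannForm.exists_isIsogenous_powers_pos A hω
  haveI : ∀ ν, Nonempty (Fin (subRank (V ν))) := fun ν ↦ ⟨⟨0, hVpos ν⟩⟩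
  exact hiso.finrank_neronSeveriGroup_eq_sq_or_le_of_powers' _ n hVs hVab hVV hn hg

/-- **Hulek–Laface 2019, Thm. 1.1 (1), as printed, for every abelian variety: "Fix `g ≥ 4`. There does not
exist any abelian variety of dimension `g` with Picard number `ρ` in the following range:
`(g−1)² + 1 < ρ < g²`."** Here an abelian variety is a complex torus `A = E/A(ℤ^ι)` with a Riemann form
(`IsAbelianVariety A`), `g = dim_ℂ E`, `ρ = rk NS(A)`. [cite: HulekLaface2019PicardNumbersAV, Thm. 1.1 (1)] -/
theorem IsAbelianVariety.not_lt_finrank_neronSeveriGroup_lt (hAV : IsAbelianVariety A) (hg : 4 ≤ finrank ℂ E) :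
    ¬ ((finrank ℂ E - 1) ^ 2 + 1 < finrank ℤ (neronSeveriGroup A) ∧
      finrank ℤ (neronSeveriGroup A) < finrank ℂ E ^ 2) := by
  rintro ⟨hlt, hlt'⟩
  rcases hAV.finrank_neronSeveriGroup_eq_sq_or_le hg with h | h
  · exact absurd h hlt'.ne
  · exact absurd h (not_le.2 hlt)

/-- **Hulek–Laface 2019, Thm. 1.1 (2), as printed, for every abelian variety: "Fix `g ≥ 7`. There does not
exist any abelian variety of dimension `g` with Picard number `ρ` in the following range:
`(g−2)² + 4 < ρ < (g−1)² + 1`."** [cite: HulekLaface2019PicardNumbersAV, Thm. 1.1 (2)] -/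
theorem IsAbelianVariety.not_lt_finrank_neronSeveriGroup_lt_secondGap (hAV : IsAbelianVariety A)
    (hg : 7 ≤ finrank ℂ E) :
    ¬ ((finrank ℂ E - 2) ^ 2 + 4 < finrank ℤ (neronSeveriGroup A) ∧
      finrank ℤ (neronSeveriGroup A) < (finrank ℂ E - 1) ^ 2 + 1) := by
  obtain ⟨ω, hω⟩ := hAV
  obtain ⟨r, V, hV, hVc, n, hVpos, hVs, hVab, hVV, hn, hiso⟩ := IsRiemannForm.exists_isIsogenous_powers_pos A hω
  haveI : ∀ ν, Nonempty (Fin (subRank (V ν))) := fun ν ↦ ⟨⟨0, hVpos ν⟩⟩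
  exact hiso.not_lt_finrank_neronSeveriGroup_lt_secondGap_of_powers' _ n hVs hVab hVV hn hg

/-- **The three largest Picard numbers** ("The following result shows the existence of two precise gaps
and characterizes the three largest Picard numbers for an abelian variety"): for every abelian variety of
dimension `g ≥ 7`, `ρ(A) ≤ (g−2)² + 4` or `ρ(A) = (g−1)² + 1` or `ρ(A) = g²`.
[cite: HulekLaface2019PicardNumbersAV, §1 (before Thm. 1.1) and Thm. 1.1] -/
theorem IsAbelianVariety.finrank_neronSeveriGroup_le_secondGap_or (hAV : IsAbelianVariety A)
    (hg : 7 ≤ finrank ℂ E) :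
    finrank ℤ (neronSeveriGroup A) ≤ (finrank ℂ E - 2) ^ 2 + 4 ∨
      finrank ℤ (neronSeveriGroup A) = (finrank ℂ E - 1) ^ 2 + 1 ∨
      finrank ℤ (neronSeveriGroup A) = finrank ℂ E ^ 2 := by
  have h1 := hAV.finrank_neronSeveriGroup_eq_sq_or_le (by omega)
  have h2 := hAV.not_lt_finrank_neronSeveriGroup_lt_secondGap hg
  omega

end Unconditional

/-! ## §7 Thm. 4.2 for every abelian variety, in the printed shapes `A ∼ E_1^{g−1} × E_2` and
`A ∼ E_1^{g−2} × E_2²` -/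

section StructureUnconditional

variable {ι : Type*} [Fintype ι] [DecidableEq ι] {E : Type*} [NormedAddCommGroup E] [NormedSpace ℂ E]

omit [DecidableEq ι] in
/-- A one-dimensional complex torus is `E_τ = ℂ/(ℤτ + ℤ)` for some `τ` in the UPPER half plane
(`exists_isIsomorphic_ellipticPeriod` gives `Im τ ≠ 0`; `E_τ ≅ E_{−τ}`, `isIsomorphic_ellipticPeriod_neg`).
[cite: Lange2023AbelianVarietiesComplex, §1.1.6 Exercise (1)(a) and §8.1 (elliptic curves `E_τ`, `τ ∈ ℍ`)] -/
theorem exists_isIsomorphic_ellipticPeriod_of_im_pos (Φ : (ι → ℝ) ≃L[ℝ] E) (hE : finrank ℂ E = 1) :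
    ∃ (τ : ℂ) (hτ : 0 < τ.im), IsIsomorphic Φ (ellipticPeriod hτ.ne') := by
  obtain ⟨τ, hτ, hΦ⟩ := exists_isIsomorphic_ellipticPeriod Φ hE
  rcases lt_or_gt_of_ne hτ with hneg | hpos
  · have hτ' : 0 < (-τ).im := by rw [Complex.neg_im]; linarith
    exact ⟨-τ, hτ', hΦ.trans (isIsomorphic_ellipticPeriod_neg hτ hτ'.ne')⟩
  · exact ⟨τ, hpos, hΦ⟩

/-- A one-dimensional torus with complex multiplication (`dim_ℚ End_ℚ = 2`) is `E_τ` with `τ ∈ ℍ`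
imaginary quadratic. [cite: Lange2023AbelianVarietiesComplex, §2.6.1 Cor. 2.6.4 and §1.1.6 Exercise (1)(a)] -/
theorem exists_isIsomorphic_ellipticPeriod_of_im_pos_of_cm (Φ : (ι → ℝ) ≃L[ℝ] E) (hE : finrank ℂ E = 1)
    (hcm : finrank ℚ (endAlgRat Φ) = 2) :
    ∃ (τ : ℂ) (hτ : 0 < τ.im), IsIsomorphic Φ (ellipticPeriod hτ.ne') ∧ ∃ a b : ℚ, τ ^ 2 + a * τ + b = 0 := by
  obtain ⟨τ, hτ, hΦ⟩ := exists_isIsomorphic_ellipticPeriod_of_im_pos Φ hE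
  refine ⟨τ, hτ, hΦ, ?_⟩
  rw [← ComplexTorus.ellipticEnd_ne_bot_iff hτ.ne', ← finrank_endAlgRat_ellipticPeriod_eq_two_iff,
    ← hΦ.isIsogenous.finrank_endAlgRat_eq]
  exact hcm

/-- **`ρ(E_{θ₁}ᵃ × E_{θ₂}ᵇ) = a² + b²` for two non-isogenous elliptic curves with complex multiplication**
(Cor. 2.3 + Cor. 2.6: `Hom(E_{θ₂}ᵇ, E_{θ₁}ᵃ) = 0`, `ρ(E_θᵏ) = k²`; the value `(g−2)² + 4` of Thm. 4.2 (2) at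
`(a, b) = (g−2, 2)`). [cite: HulekLaface2019PicardNumbersAV, §2.1 Cor. 2.3, §2.2 Cor. 2.6 and §4 Thm. 4.2 (2)] -/
theorem finrank_neronSeveriGroup_ellipticPow_prod_ellipticPow {θ₁ θ₂ : ℂ} (h₁ : 0 < θ₁.im) (h₂ : 0 < θ₂.im)
    (a b : ℕ) {p₁ q₁ p₂ q₂ : ℚ} (hq₁ : θ₁ ^ 2 + p₁ * θ₁ + q₁ = 0) (hq₂ : θ₂ ^ 2 + p₂ * θ₂ + q₂ = 0)
    (hni : ¬ IsIsogenous (ellipticPeriod h₂.ne') (ellipticPeriod h₁.ne')) :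
    finrank ℤ (neronSeveriGroup (prodPeriod (powPeriod (ellipticPeriod h₁.ne') a)
      (powPeriod (ellipticPeriod h₂.ne') b))) = a ^ 2 + b ^ 2 := by
  have hA : IsAbelianVariety (powPeriod (ellipticPeriod h₁.ne') a) := (isAbelianVariety_elliptic h₁).pow a
  rw [hA.finrank_neronSeveriGroup_prod (powPeriod (ellipticPeriod h₂.ne') b),
    finrank_neronSeveriGroup_ellipticPow_of_quadratic h₁.ne' a hq₁,
    finrank_neronSeveriGroup_ellipticPow_of_quadratic h₂.ne' b hq₂, finrank_homRat_pow,
    (isSimple_ellipticPeriod h₂.ne').homRat_eq_bot (isSimple_ellipticPeriod h₁.ne') hni, finrank_bot,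
    Nat.mul_zero, Nat.add_zero]

variable {A : (ι → ℝ) ≃L[ℝ] E}

/-- Along `A ∼ ∏_ν X_ν^{n_ν}` with `r = 0` factors `A` is a point: a decomposition of an abelian variety of
positive dimension has at least one factor. [cite: Lange2023AbelianVarietiesComplex, §2.4.4 Thm. 2.4.25] -/
private theorem pos_of_isIsogenous_powers {r : ℕ} {V : Fin r → Submodule ℝ (ι → ℝ)}
    {hV : ∀ ν, IsLatticeSubspace (V ν)} {hVc : ∀ ν, IsComplexSubspace A (V ν)} {n : Fin r → ℕ}
    (hiso : IsIsogenous A (sigmaPiPeriod fun ν ↦ powPeriod (subtorusPeriod A (V ν) (hV ν) (hVc ν)) (n ν)))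
    (hg : 0 < finrank ℂ E) : 0 < r := by
  by_contra hr
  obtain rfl : r = 0 := by omega
  have hE : finrank ℂ E = 0 := by
    rw [hiso.finrank_eq _ _, finrank_powers_eq (fun ν ↦ subtorusPeriod A (V ν) (hV ν) (hVc ν)) n,
      Finset.univ_eq_empty, Finset.sum_empty]
  omega

/-- **Hulek–Laface 2019, Thm. 4.2 (1), as printed, for every abelian variety of dimension `g ≥ 5`:
"`ρ(A) = (g−1)² + 1 ⟺ A ∼ E_1^{g−1} × E_2`, where `E_1` has complex multiplication and `E_1` and `E_2` are
not isogeneous."** Here `E_1 = E_{θ₁}`, `E_2 = E_{θ₂}` with `θ₁, θ₂` in the upper half plane, `θ₁` imaginary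
quadratic.  (⟹): the Poincaré decomposition of `A` (`IsRiemannForm.exists_isIsogenous_powers_pos`) has
length `2` with elliptic factors, exponents `(g−1, 1)` and a CM big factor
(`IsIsogenous.finrank_neronSeveriGroup_eq_sq_pred_add_one_iff_of_powers'`), and Cor. 3.2's printed shape
(`exists_isIsogenous_cm_ellipticPow_prod_of_finrank_neronSeveriGroup_eq`); (⟸): `ρ(E_{θ₁}^{g−1} × E_{θ₂}) =
(g−1)² + 1` (`finrank_neronSeveriGroup_ellipticPow_prod_ellipticPeriod`) and isogeny invariance of `ρ`.
[cite: HulekLaface2019PicardNumbersAV, §4 Thm. 4.2 (1)] -/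
theorem IsAbelianVariety.finrank_neronSeveriGroup_eq_sq_pred_add_one_iff (hAV : IsAbelianVariety A)
    (hg : 5 ≤ finrank ℂ E) :
    finrank ℤ (neronSeveriGroup A) = (finrank ℂ E - 1) ^ 2 + 1 ↔
      ∃ (θ₁ θ₂ : ℂ) (h₁ : 0 < θ₁.im) (h₂ : 0 < θ₂.im), (∃ a b : ℚ, θ₁ ^ 2 + a * θ₁ + b = 0) ∧
        ¬ IsIsogenous (ellipticPeriod h₂.ne') (ellipticPeriod h₁.ne') ∧
        IsIsogenous A (prodPeriod (powPeriod (ellipticPeriod h₁.ne') (finrank ℂ E - 1)) (ellipticPeriod h₂.ne')) := by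
  constructor
  · intro h
    obtain ⟨ω, hω⟩ := hAV
    obtain ⟨r, V, hV, hVc, n, hVpos, hVs, hVab, hVV, hn, hiso⟩ := IsRiemannForm.exists_isIsogenous_powers_pos A hω
    haveI : ∀ ν, Nonempty (Fin (subRank (V ν))) := fun ν ↦ ⟨⟨0, hVpos ν⟩⟩
    haveI : Nonempty (Fin r) := ⟨⟨0, pos_of_isIsogenous_powers hiso (by omega)⟩⟩
    set X : ∀ ν : Fin r, (Fin (subRank (V ν)) → ℝ) ≃L[ℝ] cxSpan A (V ν) :=
      fun ν ↦ subtorusPeriod A (V ν) (hV ν) (hVc ν) with hXdef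
    obtain ⟨h2, ν₀, hd, hn1, -⟩ :=
      (hiso.finrank_neronSeveriGroup_eq_sq_pred_add_one_iff_of_powers' X n hVs hVab hVV hn hg).1 h
    have hsum : ∑ ν, n ν * finrank ℂ (cxSpan A (V ν)) = finrank ℂ E := by
      rw [hiso.finrank_eq _ _, finrank_powers_eq X n]
    have hexp : ∑ ν, n ν * finrank ℂ (cxSpan A (V ν)) - (Fintype.card (Fin r) - 1) = finrank ℂ E - 1 := by
      rw [hsum, h2]
    have hmax : finrank ℤ (neronSeveriGroup (sigmaPiPeriod fun ν ↦ powPeriod (X ν) (n ν))) =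
        (∑ ν, n ν * finrank ℂ (cxSpan A (V ν)) - (Fintype.card (Fin r) - 1)) ^ 2 +
          (Fintype.card (Fin r) - 1) := by
      rw [← hiso.finrank_neronSeveriGroup_eq _ _, hexp, h2, h]
    obtain ⟨ν₁, θ, hθ, hcmθ, hdim, -, hothers, hprod⟩ :=
      exists_isIsogenous_cm_ellipticPow_prod_of_finrank_neronSeveriGroup_eq X n hVs hVab hVV hn
        (by rw [hexp]; omega) hmax
    rw [hexp] at hprod
    -- the second block has exactly one factor `X_y`
    obtain ⟨x, x', hxx', hu⟩ := exists_pair_univ_of_card_eq_two h2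
    have hmem : ∀ ν : Fin r, ν = x ∨ ν = x' := fun ν ↦ by
      have hν := Finset.mem_univ ν
      rw [hu, Finset.mem_insert, Finset.mem_singleton] at hν
      exact hν
    obtain ⟨y, hy, hyu⟩ : ∃ y, y ≠ ν₁ ∧ ∀ z, z ≠ ν₁ → z = y := by
      rcases hmem ν₁ with rfl | rfl
      · exact ⟨x', hxx'.symm, fun z hz ↦ (hmem z).resolve_left hz⟩
      · exact ⟨x, hxx', fun z hz ↦ (hmem z).resolve_right hz⟩
    letI : Unique {ν // ν ≠ ν₁} := ⟨⟨⟨y, hy⟩⟩, fun z ↦ Subtype.ext (hyu z.1 z.2)⟩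
    have hblock : IsIsomorphic (sigmaPiPeriod fun ν : {ν // ν ≠ ν₁} ↦ X ν.1) (X y) :=
      isIsomorphic_sigmaPiPeriod_unique fun ν : {ν // ν ≠ ν₁} ↦ X ν.1
    -- upper half-plane representatives
    obtain ⟨θ₁, hθ₁, hE₁⟩ := exists_isIsomorphic_ellipticPeriod_of_im_pos (ellipticPeriod hθ) (Module.finrank_self ℂ)
    obtain ⟨θ₂, hθ₂, hE₂⟩ := exists_isIsomorphic_ellipticPeriod_of_im_pos (X y) (hdim y)
    have hcm₁ : ∃ a b : ℚ, θ₁ ^ 2 + a * θ₁ + b = 0 := by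
      rw [← ComplexTorus.ellipticEnd_ne_bot_iff hθ₁.ne', ← finrank_endAlgRat_ellipticPeriod_eq_two_iff,
        ← hE₁.isIsogenous.finrank_endAlgRat_eq, finrank_endAlgRat_ellipticPeriod_eq_two_iff]
      exact hcmθ
    have hni : ¬ IsIsogenous (ellipticPeriod hθ₂.ne') (ellipticPeriod hθ₁.ne') := fun hiso₂₁ ↦
      hothers y hy (IsIsogenous.trans _ _ _ hE₂.isIsogenous
        (IsIsogenous.trans _ _ _ hiso₂₁ (IsIsogenous.symm _ _ hE₁.isIsogenous)))
    refine ⟨θ₁, θ₂, hθ₁, hθ₂, hcm₁, hni, ?_⟩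
    have e1 : IsIsogenous (powPeriod (ellipticPeriod hθ) (finrank ℂ E - 1))
        (powPeriod (ellipticPeriod hθ₁.ne') (finrank ℂ E - 1)) := hE₁.isIsogenous.pow _ _ _
    have e2 : IsIsogenous (sigmaPiPeriod fun ν : {ν // ν ≠ ν₁} ↦ X ν.1) (ellipticPeriod hθ₂.ne') :=
      IsIsogenous.trans _ _ _ hblock.isIsogenous hE₂.isIsogenous
    exact IsIsogenous.trans _ _ _ hiso (IsIsogenous.trans _ _ _ hprod (e1.prod e2))
  · rintro ⟨θ₁, θ₂, h₁, h₂, ⟨a, b, hq⟩, hni, hAiso⟩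
    rw [hAiso.finrank_neronSeveriGroup_eq _ _,
      finrank_neronSeveriGroup_ellipticPow_prod_ellipticPeriod h₁ h₂.ne' (finrank ℂ E - 1) hq hni]

/-- **Hulek–Laface 2019, Thm. 4.2 (2), as printed, for every abelian variety of dimension `g ≥ 7`:
"`ρ(A) = (g−2)² + 4 ⟺ A ∼ E_1^{g−2} × E_2²`, where `E_1` and `E_2` both have complex multiplication but
are not isogeneous."** (`E_i = E_{θ_i}`, `θ_i` in the upper half plane, imaginary quadratic.)  (⟹): the
Poincaré decomposition has length `2`, both factors CM elliptic curves, one exponent `2`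
(`IsIsogenous.finrank_neronSeveriGroup_eq_sq_sub_two_add_four_iff_of_powers'`), split as
`X_y^{n_y} × X_x^{n_x}` (`isIsomorphic_sigmaPiPeriod_sumEquiv`); (⟸): `ρ(E_{θ₁}^{g−2} × E_{θ₂}²) = (g−2)² + 2²`
(`finrank_neronSeveriGroup_ellipticPow_prod_ellipticPow`). [cite: HulekLaface2019PicardNumbersAV, §4 Thm. 4.2 (2)] -/
theorem IsAbelianVariety.finrank_neronSeveriGroup_eq_sq_sub_two_add_four_iff (hAV : IsAbelianVariety A)
    (hg : 7 ≤ finrank ℂ E) :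
    finrank ℤ (neronSeveriGroup A) = (finrank ℂ E - 2) ^ 2 + 4 ↔
      ∃ (θ₁ θ₂ : ℂ) (h₁ : 0 < θ₁.im) (h₂ : 0 < θ₂.im), (∃ a b : ℚ, θ₁ ^ 2 + a * θ₁ + b = 0) ∧
        (∃ a b : ℚ, θ₂ ^ 2 + a * θ₂ + b = 0) ∧ ¬ IsIsogenous (ellipticPeriod h₂.ne') (ellipticPeriod h₁.ne') ∧
        IsIsogenous A (prodPeriod (powPeriod (ellipticPeriod h₁.ne') (finrank ℂ E - 2))
          (powPeriod (ellipticPeriod h₂.ne') 2)) := by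
  constructor
  · intro h
    obtain ⟨ω, hω⟩ := hAV
    obtain ⟨r, V, hV, hVc, n, hVpos, hVs, hVab, hVV, hn, hiso⟩ := IsRiemannForm.exists_isIsogenous_powers_pos A hω
    haveI : ∀ ν, Nonempty (Fin (subRank (V ν))) := fun ν ↦ ⟨⟨0, hVpos ν⟩⟩
    haveI : Nonempty (Fin r) := ⟨⟨0, pos_of_isIsogenous_powers hiso (by omega)⟩⟩
    set X : ∀ ν : Fin r, (Fin (subRank (V ν)) → ℝ) ≃L[ℝ] cxSpan A (V ν) :=
      fun ν ↦ subtorusPeriod A (V ν) (hV ν) (hVc ν) with hXdef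
    obtain ⟨h2, hd, hcm, x, hx2⟩ :=
      (hiso.finrank_neronSeveriGroup_eq_sq_sub_two_add_four_iff_of_powers' X n hVs hVab hVV hn hg).1 h
    have hsum : ∑ ν, n ν * finrank ℂ (cxSpan A (V ν)) = finrank ℂ E := by
      rw [hiso.finrank_eq _ _, finrank_powers_eq X n]
    -- the two factors `x` (exponent `2`) and `y` (exponent `g − 2`)
    obtain ⟨z, z', hzz', hu⟩ := exists_pair_univ_of_card_eq_two h2
    have hmem : ∀ ν : Fin r, ν = z ∨ ν = z' := fun ν ↦ by
      have hν := Finset.mem_univ ν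
      rw [hu, Finset.mem_insert, Finset.mem_singleton] at hν
      exact hν
    obtain ⟨y, hyx, hyu⟩ : ∃ y, y ≠ x ∧ ∀ w, w ≠ x → w = y := by
      rcases hmem x with rfl | rfl
      · exact ⟨z', hzz'.symm, fun w hw ↦ (hmem w).resolve_left hw⟩
      · exact ⟨z, hzz', fun w hw ↦ (hmem w).resolve_right hw⟩
    have huniv : (Finset.univ : Finset (Fin r)) = {y, x} := by
      ext w
      simp only [Finset.mem_univ, Finset.mem_insert, Finset.mem_singleton, true_iff]
      by_cases hw : w = x
      · exact Or.inr hw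
      · exact Or.inl (hyu w hw)
    have hny : n y = finrank ℂ E - 2 := by
      have hs := hsum
      rw [huniv, Finset.sum_pair hyx, hd y, hd x, hx2, mul_one, mul_one] at hs
      omega
    -- split `∏_ν X_ν^{n_ν} ≅ X_y^{n_y} × X_x^{n_x}`
    let e : Fin r ≃ {ν // ν = y} ⊕ {ν // ν ≠ y} := (Equiv.sumCompl fun ν ↦ ν = y).symm
    have hsplit := isIsomorphic_sigmaPiPeriod_sumEquiv (fun ν ↦ powPeriod (X ν) (n ν)) e
    letI : Unique {ν // ν = y} := ⟨⟨⟨y, rfl⟩⟩, fun ν ↦ Subtype.ext ν.2⟩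
    letI : Unique {ν // ν ≠ y} := ⟨⟨⟨x, hyx.symm⟩⟩, fun w ↦ Subtype.ext <| by
      rcases hmem w.1 with hw | hw <;> rcases hmem x with hx | hx <;> rcases hmem y with hy' | hy'
      all_goals first | exact absurd (hw.trans hy'.symm) w.2 | exact hw.trans hx.symm |
        exact absurd (hy'.trans hx.symm) hyx⟩
    -- upper half-plane CM representatives of the two factors
    obtain ⟨θ₁, hθ₁, hE₁, hcm₁⟩ := exists_isIsomorphic_ellipticPeriod_of_im_pos_of_cm (X y) (hd y) (hcm y)
    obtain ⟨θ₂, hθ₂, hE₂, hcm₂⟩ := exists_isIsomorphic_ellipticPeriod_of_im_pos_of_cm (X x) (hd x) (hcm x)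
    have hni : ¬ IsIsogenous (ellipticPeriod hθ₂.ne') (ellipticPeriod hθ₁.ne') := fun hiso₂₁ ↦
      hVV x y hyx.symm (IsIsogenous.trans _ _ _ hE₂.isIsogenous
        (IsIsogenous.trans _ _ _ hiso₂₁ (IsIsogenous.symm _ _ hE₁.isIsogenous)))
    refine ⟨θ₁, θ₂, hθ₁, hθ₂, hcm₁, hcm₂, hni, ?_⟩
    have b1 : IsIsogenous (sigmaPiPeriod fun i : {ν // ν = y} ↦ powPeriod (X (e.symm (Sum.inl i))) (n (e.symm (Sum.inl i))))
        (powPeriod (ellipticPeriod hθ₁.ne') (finrank ℂ E - 2)) := by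
      refine IsIsogenous.trans _ _ _
        (isIsomorphic_sigmaPiPeriod_unique fun i : {ν // ν = y} ↦
          powPeriod (X (e.symm (Sum.inl i))) (n (e.symm (Sum.inl i)))).isIsogenous ?_
      change IsIsogenous (powPeriod (X y) (n y)) _
      rw [hny]
      exact hE₁.isIsogenous.pow _ _ _
    have b2 : IsIsogenous (sigmaPiPeriod fun j : {ν // ν ≠ y} ↦ powPeriod (X (e.symm (Sum.inr j))) (n (e.symm (Sum.inr j))))
        (powPeriod (ellipticPeriod hθ₂.ne') 2) := by
      refine IsIsogenous.trans _ _ _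
        (isIsomorphic_sigmaPiPeriod_unique fun j : {ν // ν ≠ y} ↦
          powPeriod (X (e.symm (Sum.inr j))) (n (e.symm (Sum.inr j)))).isIsogenous ?_
      change IsIsogenous (powPeriod (X x) (n x)) _
      rw [hx2]
      exact hE₂.isIsogenous.pow _ _ _
    exact IsIsogenous.trans _ _ _ hiso (IsIsogenous.trans _ _ _ hsplit.isIsogenous (b1.prod b2))
  · rintro ⟨θ₁, θ₂, h₁, h₂, ⟨a, b, hq₁⟩, ⟨a', b', hq₂⟩, hni, hAiso⟩
    rw [hAiso.finrank_neronSeveriGroup_eq _ _,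
      finrank_neronSeveriGroup_ellipticPow_prod_ellipticPow h₁ h₂ (finrank ℂ E - 2) 2 hq₁ hq₂ hni]
    norm_num

end StructureUnconditional

/-! ## §8 Self-products: `ρ(A) ≤ ½ g(g+1)` for `A ∼ Bᵏ` with `B` simple, unless `A ∼ E^g` with `E` CM -/

section SelfProducts

/-- **The type-free bound against `½ g(g+1)`: `k p + C(k,2)·2b ≤ C(bk + 1, 2)`** for `b ≥ 2`, `p ≤ 2b`,
`p + 1 ≤ b²` (`k = m + 1`; for `b = 2` this is the equality `3k + 2k(k−1) = ½ (2k)(2k+1)` using `ρ(B) ≤ 3`,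
for `b ≥ 3` it follows from `b k (k+1) ≤ ½ bk (bk+1)`). [cite: HulekLaface2019PicardNumbersAV, §7.2 ("bounded by `½ g(g+1)`") and §3.2 (b)] -/
theorem pow_bound_le_choose {b m p : ℕ} (hb : 2 ≤ b) (hp : p ≤ 2 * b) (hp' : p + 1 ≤ b ^ 2) :
    (m + 1) * p + (m + 1).choose 2 * (2 * b) ≤ (b * (m + 1) + 1).choose 2 := by
  have h2 := two_mul_choose_succ_two m
  have hg2 := two_mul_choose_succ_two (b * (m + 1))
  rcases hb.eq_or_lt with rfl | hb3
  · -- `b = 2`: `ρ(B) ≤ 3`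
    have hp3 : p ≤ 3 := by omega
    have hpf : (m + 1) * p ≤ (m + 1) * 3 := Nat.mul_le_mul_left _ hp3
    nlinarith
  · have hT := pow_bound_le_mul b m p hp
    have hm : 2 * (m + 2) ≤ b * (m + 1) + 1 := by nlinarith
    have h' : b * (m + 1) * (2 * (m + 2)) ≤ b * (m + 1) * (b * (m + 1) + 1) := Nat.mul_le_mul_left _ hm
    have e1 : b * (m + 1) * (2 * (m + 2)) = 2 * (b * (m + 1) * (m + 2)) := by ring
    have e2 : (b * (m + 1) + 1) * (b * (m + 1)) = b * (m + 1) * (b * (m + 1) + 1) := by ring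
    omega

variable {ι : Type*} [Fintype ι] [DecidableEq ι] {E : Type*} [NormedAddCommGroup E] [NormedSpace ℂ E]
  {ρ : Type*} [Fintype ρ] {τ : ρ → Type*} [∀ ν, Fintype (τ ν)] [∀ ν, DecidableEq (τ ν)]
  [∀ ν, Nonempty (τ ν)]
  {G : ρ → Type*} [∀ ν, NormedAddCommGroup (G ν)] [∀ ν, NormedSpace ℂ (G ν)]
  (X : ∀ ν, (τ ν → ℝ) ≃L[ℝ] G ν) (n : ρ → ℕ)

/-- **Hulek–Laface 2019, §7.2, along a Poincaré decomposition of length `1`: "all Picard numbers of abelian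
varieties of dimension `g` that are isogenous to a self-product of a simple abelian variety are bounded by
`½ g(g+1)`, unless we are considering the `g`-fold product of a CM elliptic curve, in which case the
maximal Picard number is attained."**  For `A ∼ X_{ν₀}^{n}` (`r(A) = 1`): `ρ(A) = g²` or
`ρ(A) ≤ C(g+1, 2) = ½ g(g+1)` — the elliptic factor gives `g²` (CM) or exactly `C(g+1, 2)` (no CM), a
simple factor of dimension `b ≥ 2` gives `ρ(A) ≤ k ρ(B) + C(k,2)·2b ≤ C(g+1, 2)` (`pow_bound_le_choose`).
[cite: HulekLaface2019PicardNumbersAV, §7.2 (the paragraph before "large Picard numbers") and §3.2 (b)] -/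
theorem IsIsogenous.finrank_neronSeveriGroup_eq_sq_or_le_choose_of_card_eq_one {A : (ι → ℝ) ≃L[ℝ] E}
    (hiso : IsIsogenous A (sigmaPiPeriod fun ν ↦ powPeriod (X ν) (n ν))) (hX : ∀ ν, IsSimple (X ν))
    (hA : ∀ ν, IsAbelianVariety (X ν)) (hn : ∀ ν, 0 < n ν) (h1 : Fintype.card ρ = 1) :
    finrank ℤ (neronSeveriGroup A) = finrank ℂ E ^ 2 ∨
      finrank ℤ (neronSeveriGroup A) ≤ (finrank ℂ E + 1).choose 2 := by
  by_cases hd : ∀ ν, finrank ℂ (G ν) = 1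
  · rcases hiso.finrank_neronSeveriGroup_eq_sq_or_eq_choose_of_card_eq_one X n h1 hd with h | h
    · exact Or.inl h
    · exact Or.inr h.le
  · push Not at hd
    obtain ⟨ν₀, huniq⟩ := Fintype.card_eq_one_iff.1 h1
    letI : Unique ρ := { default := ν₀, uniq := huniq }
    haveI : FiniteDimensional ℂ (G ν₀) := finiteDimensional_complex_of_period (X ν₀)
    obtain ⟨ν, hν⟩ := hd
    have hν₀ : finrank ℂ (G ν₀) ≠ 1 := huniq ν ▸ hν
    have hAX : IsIsogenous A (powPeriod (X ν₀) (n ν₀)) :=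
      IsIsogenous.trans _ _ _ hiso (isIsomorphic_sigmaPiPeriod_unique fun ν ↦ powPeriod (X ν) (n ν)).isIsogenous
    have hb1 : 0 < finrank ℂ (G ν₀) := finrank_pos_of_nonempty (X ν₀)
    have hb2 : 2 ≤ finrank ℂ (G ν₀) := by omega
    obtain ⟨m, hm⟩ : ∃ m, n ν₀ = m + 1 := ⟨n ν₀ - 1, by have := hn ν₀; omega⟩
    have hg : finrank ℂ E = finrank ℂ (G ν₀) * (m + 1) := by
      rw [hAX.finrank_eq _ _, finrank_fin_fun, hm, mul_comm]
    have hρ : finrank ℤ (neronSeveriGroup A) ≤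
        (m + 1) * finrank ℤ (neronSeveriGroup (X ν₀)) + (m + 1).choose 2 * (2 * finrank ℂ (G ν₀)) := by
      rw [hAX.finrank_neronSeveriGroup_eq _ _, hm]
      exact (hX ν₀).finrank_neronSeveriGroup_pow_le (hA ν₀) (m + 1)
    refine Or.inr (hρ.trans ?_)
    rw [hg]
    exact pow_bound_le_choose hb2 ((hX ν₀).finrank_neronSeveriGroup_le_two_mul_finrank (hA ν₀))
      ((hX ν₀).finrank_neronSeveriGroup_succ_le_sq hb2)

end SelfProducts

section SelfProductsPow

variable {ι : Type*} [Fintype ι] [DecidableEq ι] {E : Type*} [NormedAddCommGroup E] [NormedSpace ℂ E]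
  {κ : Type*} [Fintype κ] [DecidableEq κ] [Nonempty κ] {H : Type*} [NormedAddCommGroup H] [NormedSpace ℂ H]

/-- **The same statement for `A ∼ Bᵏ` given directly** (`B` simple, `k ≥ 1`, `A` an abelian variety — then
so is `B`): `ρ(A) = g²` or `ρ(A) ≤ ½ g(g+1)`; hence a "large" Picard number `½ g(g+1) < ρ(A) < g²` forces
`r(A) ≥ 2`. [cite: HulekLaface2019PicardNumbersAV, §7.2 (the paragraph before "large Picard numbers")] -/
theorem IsIsogenous.finrank_neronSeveriGroup_eq_sq_or_le_choose_of_pow {A : (ι → ℝ) ≃L[ℝ] E}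
    {B : (κ → ℝ) ≃L[ℝ] H} {k : ℕ} (hiso : IsIsogenous A (powPeriod B k)) (hB : IsSimple B)
    (hAV : IsAbelianVariety A) (hk : 0 < k) :
    finrank ℤ (neronSeveriGroup A) = finrank ℂ E ^ 2 ∨
      finrank ℤ (neronSeveriGroup A) ≤ (finrank ℂ E + 1).choose 2 := by
  have hiso' : IsIsogenous A (sigmaPiPeriod fun _ : Fin 1 ↦ powPeriod B k) :=
    IsIsogenous.trans _ _ _ hiso (isIsomorphic_sigmaPiPeriod_unique fun _ : Fin 1 ↦ powPeriod B k).symm.isIsogenous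
  have hBab : IsAbelianVariety B :=
    IsAbelianVariety.of_pow hk ((hiso.isAbelianVariety_iff).1 hAV)
  exact hiso'.finrank_neronSeveriGroup_eq_sq_or_le_choose_of_card_eq_one (fun _ : Fin 1 ↦ B) (fun _ ↦ k)
    (fun _ ↦ hB) (fun _ ↦ hBab) (fun _ ↦ hk) (Fintype.card_fin 1)

end SelfProductsPow

end ComplexTorus

end Literature.Geometry.Kaehler

end
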